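import Summits.ValiantsHypothesis.ValiantsHypothesis.Theorems.PolyaContinuedLaplaceRigidityStrength
import Summits.ValiantsHypothesis.ValiantsHypothesis.Theorems.PolyaContinuedLaplaceRigiditySingCodimEight
import Summits.ValiantsHypothesis.ValiantsHypothesis.Theorems.PolyaContinuedLaplaceRigiditySingTopZeroLine
import Summits.ValiantsHypothesis.ValiantsHypothesis.Theorems.PolyaContinuedLaplaceRigiditySingTopLines
import Summits.ValiantsHypothesis.ValiantsHypothesis.Theorems.PolyaContinuedLaplaceRigiditySingKCoreStubs
import Summits.ValiantsHypothesis.ValiantsHypothesis.Theorems.PolyaContinuedLaplaceRigidityTwoLineCase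
import Summits.ValiantsHypothesis.ValiantsHypothesis.Theorems.PolyaContinuedStrengthTwoPerFourGeFive
import Literature.Computability.AlgebraicComplexity.PermanentIrreducible
import HarnessLib

/-!
# Crux `CoverDecancellation` (stmt-ValiantsHypothesis-17819) — line `component_rigidity`
# (val-idea-10 g3, LENS strengthen): the NEXT RUNG of the strength ladder, `str₂(per₄) ≥ 5`

**What this line is.**  A RUNG LINE on the ladder of line `laplace_rigidity` (law `LaplaceRigidity`:
`str_k(per_n) = C(n,k)`; first per/det-separating instance `(n,k) = (4,2)`, where `det₄` has two-factor
width `3` and the law predicts `6` for `per₄`).  Tree state 2026-08-28: `str₂(per₄) ≥ 4` is PROVED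
(`…Theorems.PolyaContinuedLaplaceRigidity.Strength.strengthTwoPerFourGeFour`, item stmt-27078 CLOSED), via
`codim Sing(per₄) ≥ 7` and Kumar's ideal; `codim Sing(per₄) = 8` is PROVED
(`…SingCodim.height_singPermIdeal_four_complex`); the route's support item `StrengthTwoPerFour`
(stmt-25160, width `5` impossible) is GATED, and the singular-locus instrument was declared exhausted at
`(4,2)` because `2w ≥ codim Sing = 8` only gives `w ≥ 4` (director-valiant R195).

**The lever (component rigidity).**  The EQUALITY CASE `2w = codim Sing(per₄) = 8` of Kumar's bound is
rigid.  If `per₄ = Σ_{k<4} p_k q_k` with quadrics `p_k, q_k`, the ideal `J = (p_k, q_k)_k` has `≤ 8`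
generators and contains `singPermIdeal ℂ 4 = (per₄, ∂per₄)` (Leibniz), whose height is `8`; so SOME
minimal prime `P ⊇ J` has height `≤ 8` (Krull), hence exactly `8`: `P` is the ideal of a TOP-DIMENSIONAL
irreducible component of `Sing(per₄) = {all 3×3 sub-permanents vanish}`.  These components can be
CLASSIFIED (support theorem `…SupportPatterns.support_of_subperm_vanish` + a corank stratification of the
symmetric zero-diagonal matrix `M(u,v)`, `M_{cd} = per₂` of the `2×4` matrix `[u;v]` on the columns
complementary to `{c,d}`, whose determinant is the absolutely irreducible octic
`det M = 16·u₁u₂u₃u₄·v₁v₂v₃v₄ − 4·(Σ_c v_c ∏_{d≠c} u_d)(Σ_c u_c ∏_{d≠c} v_d)`):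
(L) two zero rows / two zero columns (12 linear components); (X) zero row `i`, zero column `c`, `per₃` of
the complementary minor (16); (K) zero row (or column) times the kernel incidence
`K = closure {(r,u,v) : det M(u,v) = 0, M(u,v) r = 0}` of the other three rows (8).  IN PRINT: this is
exactly the height-8 part of Kirkup's list of the minimal primes over `I₃(4,4)` — types (1) = two lines,
(3) = (X), (3A) = (K) = `J₃ +` a row; types (2), (2,2) and the 3×3-block primes of type (1) have height
`≥ 9` (G. Kirkup, *Minimal primes over permanental ideals*, Trans. AMS 360 (2008) 3751–3770 =
arXiv:math/0510025, Thm 14; `J₃` prime of codimension 4, Prop 11; Betti table of `J₃`: minimal generators in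
degrees 3, 6, 8 only, p. 11 — the last two by Singular/Macaulay2 there, CAS-free here via the octic).  For (X) and (K) every
QUADRIC of `P` lies in the ideal of the variables of row `i` ∪ column `c` (for (K): no polynomial of
degree `≤ 2` vanishes on `K` — degree count against the irreducible octic); for (L), `P` IS the ideal of
two parallel lines.  This is the theorem `topPrimeRigidity_of` below (its K-core inputs T7/T8 are 17819-w1 g2's tree theorems, wired by name in v8.1).  The kernel-checked glue
`strengthTwoPerFourGeFive_of` then finishes: in case (X)/(K), `per₄ = Σ p_k q_k ∈ (x_S)²` with
`S = row i ∪ col c`, impossible because the permutation monomial through the cell `(i,c)` meets `S` once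
(proved here, `perPoly_not_mem_sdegIdeal_rowCol`); case (L) is `stub_twoLineCase` — since v8 a THEOREM given
B (no width-4 decomposition with all eight factors in the ideal of two parallel lines: bigrading ⇒ a
BILINEAR width-4 identity across the 2+2 split; B applied to the minimal primes of the second ideal
`(a,b)` ⇒ every common zero of the eight bilinear quadrics has two zero lines; an explicit common zero with
zero-free rows `i,i'` and a nonzero free entry — linear algebra on the `8 × 8` evaluation map — refutes
that).  Card: `Lines/component_rigidity.md`.

**Audit (v8.3, 2026-08-28T11:50Z — FINAL, record only, R231 (d)).**  THE RUNG IS BOOKED: stmt-ValiantsHypothesis-27571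
`Theses.PolyaContinued.StrengthTwoPerFourGeFive` (`str₂(per₄) ≥ 5`, support r9) **CLOSED · proved 11:36:03Z** by
`Theorems.PolyaContinuedLaplaceRigidity.StrengthFive.strengthTwoPerFourGeFive` (✓ p629836, val-port-2 g1) over
`TopPrime.topPrimeRigidity` (✓ p629522) and `TwoLine.twoLineCase_of_topPrimeRigidity` (✓ p628909); v8.3 = v8.2 + the
import of `…PolyaContinuedStrengthTwoPerFourGeFive` and three by-name anchors at the end of the file
(`stub_topPrimeRigidity_byName`, `strengthTwoPerFourGeFive_byName`, and `example : Theses.….StrengthTwoPerFourGeFive :=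
strengthTwoPerFourGeFive_holds`).  `lean check` rc 0; sorries 0; axioms std.  Honest frame unchanged: a SUPPORT rung,
never distance-to-summit; 25160 «= 6» GATED; crux 17819 `CoverDecancellation` HELD, untouched; `VP ≠ VNP` NOT proved.

**Audit (v8.2, 2026-08-28T11:45Z — record-only wire, R228 (a)).**  v8.1 + the by-name anchor
`stub_twoLineCase_of_topPrimeRigidity_byName := TwoLine.twoLineCase_of_topPrimeRigidity` (port-2 g1's Theorems-side
stub C, p628909; δ-identical to this file's `TopPrimeRigidity → TwoLineCase`).  The Theorems-side port of stub B
(D `…TopPrimeRigidity.lean`, writer 17819-w1 g3) and the 27571 closer (E, writer port-2 g1) are supplied as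
farm-clean sources in `Lines/component_rigidity_portD_TopPrimeRigidity.lean` / `…_portDE_check.lean` (README
`Lines/component_rigidity_port.md`); when E lands, `StrengthTwoPerFourGeFive` (= stmt-27571, support r9) is closed
in the ledger by `TwoLine.strengthTwoPerFourGeFive`.  `lean check` rc 0; sorries 0; axioms std.

**Audit (v8.1, 2026-08-28T11:16Z).**  `lean check` rc 0; **sorries = 0** — the file is SORRY-FREE END
TO END: `strengthTwoPerFourGeFive_holds : StrengthTwoPerFourGeFive` (`str₂(per₄) ≥ 5`) is a kernel-closed
witness over tree theorems only (audit: `StrengthTwoPerFourGeFive` closed, witness kernel-closed; axioms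
std).  The two K-core stubs `stub_kcore_noVar` (T7) / `stub_kcore_noBinomial` (T8) are now one-line
`exact`s of 17819-w1 g2's tree theorems `SingCodim.kcore_noVar` / `SingCodim.kcore_noBinomial`
(p627865 `…SingKCoreStubs.lean`, over p625549 LemmaA, p625969 Kernel, p626296 Line, p626822 Octic
(T7 `coord_ne_zero`), p627111 Binomial (T8 `binomial_ne_zero`); director R222 (a)).  **Stub C is now a THEOREM here,
sorry-free, end to end** (`stub_twoLineCase`): v7's last stub `stub_twoRows_badPoint` is PROVED in v8
(section `BadPoint`: the evaluation map of the eight bilinear quadrics along the affine family "rows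
`i,i'` = `(1,1,1,1),(1,−1,1,1)`, other rows free" is a linear endomorphism `Lam` of `ℂ^{2×4}`; kernel
vector ⇒ point; else bijective (`LinearMap.injective_iff_surjective`) and the translation invariance
`per₄(pt(zz + zz*)) = per₄(pt zz)` (`eval_pt_perPoly_shift`, from `Matrix.permanent_fin_four_row` by
`ring` — the certificate `M(y₀)·(1,0,−1,0) = 0`) would force `Lam zz* = 0` for the split form
(`splitForm_shift_eq_zero`), contradicting `zz* ≠ 0`).  Also PROVED HERE, sorry-free: the grading half of
LEMMA B `kcore_grading` (ℕ-weight `wK = 2^ρ + 16·2^c`, `singPermIdeal` `wK`-closed, height-8 primes over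
it are minimal hence `wK`-closed, component decoding `wK_decode`), the B-row composition
`rowPrimeRigidity_of_kcore` (cases (L)/(X) closed by 17819-w1 g2's p624852 `eq_span_X_twoRows` /
`quadric_mem_span_rowCol`), `topPrimeRigidity_of` (zero line, p623618), B-col `colPrimeRigidity_of_row`
(transpose automorphism `tr`), the (X)/(K) kill `perPoly_not_mem_sdegIdeal_rowCol`, and stub C GIVEN B:
`twoLine_bilinear_reduction` (C-i: indicator weight `wS`, `per₄` has `wS`-weight 2, quadrics of `(x_S)`
have no weight-0 part, weight-2 part of the product = product of the weight-1 parts),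
`minimalPrimes_decompIdeal_twoLine` (C-ii: B applied to the minimal primes of the SECOND 8-generated
ideal `(a, b) ⊇ singPermIdeal`), `commonZero_twoLine` (C-iii-a: `ker (eval pt)` is prime,
`Ideal.exists_minimalPrimes_le`), `twoRows_badPoint` (C-iii-b, above), `twoRowsCase_of_topPrimeRigidity`
(rows `i, i'` of the bad point are zero-free, so the two vanishing lines are the other two rows —
pigeonhole on `Fin 4` — contradicting the nonzero free coordinate), `twoLineCase_of_topPrimeRigidity`
(columns ↦ rows by `tr`), and the composition
`strengthTwoPerFourGeFive_of : TopPrimeRigidity → TwoLineCase → StrengthTwoPerFourGeFive`.  So the rung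
`str₂(per₄) ≥ 5` is, in this file, EXACTLY `T7 ∧ T8 → StrengthTwoPerFourGeFive` with T7, T8 proved in
the tree modulo one pending signatures file.
HONEST FRAMING: this line concludes the RUNG `StrengthTwoPerFourGeFive`
(`str₂(per₄) ≥ 5`), strictly between the closed rung (`≥ 4`) and the gated item stmt-25160 (`= 6`); it does
NOT conclude `CoverDecancellation` (calibrated ≥ summit, HELD, untouched), nor `CentralLaplaceRigidity`,
nor VP ≠ VNP — none of these is moved.  `S⁺ ≥ CD`.  kit: j305168 (numerical min-rank falsifier for
`stub_twoLineCase`, see card).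

References: G. Kirkup, Trans. Amer. Math. Soc. 360 (2008) 3751–3770 (arXiv:math/0510025), Thm 14,
Prop 11, §7; M. Kumar, comput. complexity 28 (2019) §1.2; Gesmundo–Ghosal–Ikenmeyer–Lysikov,
arXiv:2205.02149, Def. 10 / Prop. 6 / Cor. 13; Alper–Bogart–Velasco, Found. Comput. Math. 17 (2017) §1,
Rem. 1.5; arXiv:2509.06294 Thm 1–3 (`prk(det₄) = 3`); Boralevi–Carlini–Michałek–Ventura, Adv. Math. 461
(2025) 110079 = arXiv:2402.17839, Prop. 3.10, Conj. 4.27 (`codim Sing(per_n) = 2n`); J. von zur Gathen,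
Linear Algebra Appl. 96 (1987) §2.
-/

-- single-conjunct layout: Sub = Summit, duplicated namespace component intended
set_option linter.dupNamespace false

noncomputable section

open MvPolynomial

namespace Summit.ValiantsHypothesis.ValiantsHypothesis.Cruxes.CoverDecancellation.ComponentRigidity

open Literature.Computability.AlgebraicComplexity

/-! ## The rung -/

/-- **RUNG `str₂(per₄) ≥ 5`**: the `4 × 4` permanent over `ℂ` is not a sum of FOUR products `p_k q_k`
of homogeneous quadrics.  (Tree: not a sum of three — `strengthTwoPerFourGeFour`; `det₄` is a sum of
three; the route's support item `StrengthTwoPerFour`, stmt-25160, says not a sum of five.)  Same shape as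
`…Theses.PolyaContinued.StrengthTwoPerFourGeFour` with `Fin 3 ↦ Fin 4`. -/
def StrengthTwoPerFourGeFive : Prop :=
  ∀ p q : Fin 4 → MvPolynomial (Fin 4 × Fin 4) ℂ,
    ¬ ((∀ i, (p i).IsHomogeneous 2) ∧ (∀ i, (q i).IsHomogeneous 2) ∧
        perPoly (Fin 4) ℂ = ∑ i, p i * q i)

/-! ## Cell sets and their variable ideals -/

/-- The ideal generated by the variables of a set of cells `S ⊆ [4] × [4]`. -/
def cellIdeal (S : Finset (Fin 4 × Fin 4)) : Ideal (MvPolynomial (Fin 4 × Fin 4) ℂ) :=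
  Ideal.span ((fun e => (X e : MvPolynomial (Fin 4 × Fin 4) ℂ)) '' (S : Set (Fin 4 × Fin 4)))

/-- Row `i` ∪ column `c` (7 cells). -/
def rowCol (i c : Fin 4) : Finset (Fin 4 × Fin 4) :=
  Finset.univ.filter fun e => e.1 = i ∨ e.2 = c

/-- Rows `i` and `i'` (8 cells). -/
def twoRows (i i' : Fin 4) : Finset (Fin 4 × Fin 4) :=
  Finset.univ.filter fun e => e.1 = i ∨ e.1 = i'

/-- Columns `j` and `j'` (8 cells). -/
def twoCols (j j' : Fin 4) : Finset (Fin 4 × Fin 4) :=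
  Finset.univ.filter fun e => e.2 = j ∨ e.2 = j'

/-! ## The two stubs (statements as named `Prop`s, so that the composition reads
`TopPrimeRigidity → TwoLineCase → StrengthTwoPerFourGeFive`) -/

/-- **Stub B — TOP-PRIME RIGIDITY of `Sing(per₄)`** (the load-bearing stub).  Every prime `P` of height
`≤ 8` containing `singPermIdeal ℂ 4` (so `P` is a minimal prime of the height-8 ideal of `Sing(per₄)`, the
ideal of a top-dimensional component) EITHER has all its quadrics in the variable ideal of some
row `i` ∪ column `c` (components of type (X): zero row + zero column + `per₃`; and (K): zero line + kernel
incidence of the octic `det M(u,v) = 0` — no polynomial of degree `≤ 2` vanishes on `K`), OR is the ideal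
of the variables of two rows or of two columns (type (L)).  Why it might fail: an overlooked
top-dimensional component of `{all 3×3 sub-permanents of a 4×4 vanish}` carrying a quadric outside every
`(x_{row i ∪ col c})` — excluded on paper by the corank stratification of `M` (corank ≥ 2 only on loci of
dimension ≤ 6) and checked numerically (rank 91/91 of the degree-≤2 monomials on 130 sampled points of `K`). -/
def TopPrimeRigidity : Prop :=
  ∀ P : Ideal (MvPolynomial (Fin 4 × Fin 4) ℂ), P.IsPrime →
    VonZurGathen.singPermIdeal ℂ 4 ≤ P → P.height ≤ 8 →
      (∃ i c : Fin 4, ∀ f ∈ P, f.IsHomogeneous 2 → f ∈ cellIdeal (rowCol i c)) ∨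
      (∃ i i' : Fin 4, i ≠ i' ∧ (P = cellIdeal (twoRows i i') ∨ P = cellIdeal (twoCols i i')))

/-- **Stub C — THE TWO-LINE CASE.**  `per₄` has no width-4 decomposition `Σ_{k<4} p_k q_k` by quadrics
ALL EIGHT of which vanish on the linear space {rows `i`, `i'` zero} (resp. two columns).  Proof plan
(card §Stubs): the bigrading by the two rows turns it into a BILINEAR identity
`per₄ = Σ_{k<4} B_k(u,v) B'_k(u,v)` (`u` = the 8 entries of rows `i,i'`, `v` = the other 8); the
`8 × 8` matrix `M_B(u)` of the bilinear system is generically nonsingular (else a 9-dimensional piece of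
`Sing(per₄)`), and the kernel incidence over an irreducible factor `h` of `det M_B(u)` is a height-8 prime
over `singPermIdeal` whose contraction to `ℂ[u]` is `(h)`, principal and nonzero — by `TopPrimeRigidity`'s
classification only type (K) has that property, and type (K) forces `B_k, B'_k ∈ (x_{third row})`, i.e.
`per₄ ∈ (x_{row})²`, absurd.  Why it might fail: the classification step inside (same risk as Stub B);
cheapest falsifier = a rank-≤8 representative in `per₄`'s bilinear Gram coset (kit j305168 searches). -/
def TwoLineCase : Prop :=
  ∀ i i' : Fin 4, i ≠ i' → ∀ S : Finset (Fin 4 × Fin 4), (S = twoRows i i' ∨ S = twoCols i i') →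
    ∀ p q : Fin 4 → MvPolynomial (Fin 4 × Fin 4) ℂ,
      (∀ k, p k ∈ cellIdeal S) → (∀ k, q k ∈ cellIdeal S) →
        ¬ ((∀ k, (p k).IsHomogeneous 2) ∧ (∀ k, (q k).IsHomogeneous 2) ∧
            perPoly (Fin 4) ℂ = ∑ k, p k * q k)

/-- Stub B-row (registered stub; size M–L): the 3×4 content of top-prime rigidity.  A height-`≤ 8`
prime over `singPermIdeal ℂ 4` that contains all four variables of row `i` either has all its
homogeneous quadrics inside `(x_e : e ∈ row i ∪ col c)` for some column `c` (types (X), (K)), or is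
the ideal of two rows.  Route (card v2.2, S3 → S1 → S2, CAS-free): `P = (x_{i·}) + P'` with `P'` a
height-4 prime over the 3×3 sub-permanents of the other three rows; `P'` contains a further row (⇒ two
rows), or the column prime `(x_{·c}) + (per₃)` (⇒ (X)), or no variable, and then `(P')₂ = 0` by torus
grading + a transcendence-degree count over the kernel line of `M(u,v)`.  In print: Kirkup 2008
Thm 14 (height-8 part) with Prop 11 / the Betti table of `J₃`.
[cite: Kirkup2008, Thm 14, Prop 11; AlperBogartVelasco2017, §1] -/
def RowPrimeRigidity : Prop :=
  ∀ P : Ideal (MvPolynomial (Fin 4 × Fin 4) ℂ), P.IsPrime →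
    VonZurGathen.singPermIdeal ℂ 4 ≤ P → P.height ≤ 8 → ∀ i : Fin 4,
      (∀ j : Fin 4, (X (i, j) : MvPolynomial (Fin 4 × Fin 4) ℂ) ∈ P) →
        (∃ c : Fin 4, ∀ f ∈ P, f.IsHomogeneous 2 → f ∈ cellIdeal (rowCol i c)) ∨
        (∃ i' : Fin 4, i ≠ i' ∧ P = cellIdeal (twoRows i i'))

/-- Stub B-col (registered stub; size S given B-row: the transpose `x_{ij} ↦ x_{ji}` is a ring
automorphism fixing `per₄` and `singPermIdeal ℂ 4` and exchanging rows and columns; or re-run the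
B-row proof verbatim on columns). [cite: Kirkup2008, Thm 14] -/
def ColPrimeRigidity : Prop :=
  ∀ P : Ideal (MvPolynomial (Fin 4 × Fin 4) ℂ), P.IsPrime →
    VonZurGathen.singPermIdeal ℂ 4 ≤ P → P.height ≤ 8 → ∀ c : Fin 4,
      (∀ r : Fin 4, (X (r, c) : MvPolynomial (Fin 4 × Fin 4) ℂ) ∈ P) →
        (∃ i : Fin 4, ∀ f ∈ P, f.IsHomogeneous 2 → f ∈ cellIdeal (rowCol i c)) ∨
        (∃ c' : Fin 4, c ≠ c' ∧ P = cellIdeal (twoCols c c'))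

/-! ### B-row = types (L) and (X) (LANDED: 17819-w1 g2, p624852 `…SingTopLines`:
`eq_span_X_twoRows`, `quadric_mem_span_rowCol`) + the K-CORE, split (v5) into the producers'
deliverables: `stub_kcore_noVar` (17819-w1's T7: every coordinate of the generic point outside row `i`
is non-zero), `stub_kcore_noBinomial` (T8: no binomial `x_{ρc}x_{ρ'c'} − γ x_{ρc'}x_{ρ'c}` in `P`) and
`kcore_grading` (LEMMA B (B-i)+(B-ii): torus grading ⇒ the quadrics of `P` lie in `(x_{row i})` —
PROVED in v6, sorry-free).  They compose to `RowPrimeRigidity` by the sorry-free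
`rowPrimeRigidity_of_kcore`; the registered stubs of B-row are now ONLY `stub_kcore_noVar` and
`stub_kcore_noBinomial`. -/

/-- the cells of row `i` -/
def rowCells (i : Fin 4) : Finset (Fin 4 × Fin 4) :=
  Finset.univ.filter fun e => e.1 = i

theorem rowCells_subset_rowCol (i c : Fin 4) : rowCells i ⊆ rowCol i c := by
  intro e he
  simp only [rowCells, rowCol, Finset.mem_filter, Finset.mem_univ, true_and] at he ⊢
  exact Or.inl he

/-! ### LEMMA B machinery (sorry-free): the weight `wK`, its decoding, `wK`-closure of
`singPermIdeal ℂ 4`, minimality of height-8 primes over it, and the grading half of LEMMA B -/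

/-- shorthand for the coordinate ring of `4 × 4` matrices -/
abbrev R44 := MvPolynomial (Fin 4 × Fin 4) ℂ

section GradingMachinery
open Finsupp

section LemmaBTool
variable {σ : Type*} (w : σ → ℕ)

/-- **LEMMA B (B-i), instance-free form.**  If `I` is closed under taking `w`-weighted homogeneous
components (e.g. generated by `w`-homogeneous elements) and `P` is a minimal prime over `I`, then `P`
is closed under `w`-components too.  Proof: Mathlib's `Ideal.IsPrime.homogeneousCore` for the graded
structure `MvPolynomial.weightedGradedAlgebra ℂ w` (used only inside the proof). -/
theorem weightedHomogeneousComponent_mem_of_mem_minimalPrimes {I P : Ideal (MvPolynomial σ ℂ)}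
    (hI : ∀ m : ℕ, ∀ f ∈ I, weightedHomogeneousComponent w m f ∈ I) (hP : P ∈ I.minimalPrimes)
    {f : MvPolynomial σ ℂ} (hf : f ∈ P) (m : ℕ) :
    weightedHomogeneousComponent w m f ∈ P := by
  classical
  letI : GradedAlgebra (weightedHomogeneousSubmodule ℂ w) := weightedGradedAlgebra ℂ w
  let 𝒜 := weightedHomogeneousSubmodule ℂ w
  have hdec : ∀ (r : MvPolynomial σ ℂ) (i : ℕ),
      ((DirectSum.decompose 𝒜 r) i : MvPolynomial σ ℂ) = weightedHomogeneousComponent w i r :=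
    fun r i => weightedDecomposition.decompose'_apply ℂ w r i
  have hI' : I.IsHomogeneous 𝒜 := fun i r hr => by rw [hdec]; exact hI i r hr
  have hPprime : P.IsPrime := hP.1.1
  have hIP : I ≤ P := hP.1.2
  have hcore_prime := hPprime.homogeneousCore (𝒜 := 𝒜)
  have hcore_le : (P.homogeneousCore 𝒜).toIdeal ≤ P := Ideal.toIdeal_homogeneousCore_le _ _
  have hI_le_core : I ≤ (P.homogeneousCore 𝒜).toIdeal := by
    rw [← hI'.toIdeal_homogeneousCore_eq_self]
    exact Ideal.homogeneousCore_mono _ hIP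
  have heq : (P.homogeneousCore 𝒜).toIdeal = P :=
    le_antisymm hcore_le (hP.2 ⟨hcore_prime, hI_le_core⟩ hcore_le)
  have hPhom : P.IsHomogeneous 𝒜 := heq ▸ (P.homogeneousCore 𝒜).isHomogeneous
  rw [← hdec]
  exact hPhom m hf

end LemmaBTool

/-! ### G0: degree-two exponent vectors are pairs -/

theorem exists_pair_of_weight_one_eq_two {σ : Type*} (d : σ →₀ ℕ)
    (h : weight (1 : σ → ℕ) d = 2) : ∃ a b : σ, d = single a 1 + single b 1 := by
  classical
  have hcard : Multiset.card (toMultiset d) = 2 := by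
    rw [card_toMultiset]
    simpa [weight_apply, Finsupp.sum] using h
  obtain ⟨x, y, hxy⟩ := Multiset.card_eq_two.1 hcard
  refine ⟨x, y, ?_⟩
  have := congrArg Multiset.toFinsupp hxy
  rw [Finsupp.toMultiset_toFinsupp] at this
  rw [this, Multiset.insert_eq_cons, ← Multiset.singleton_add, Multiset.toFinsupp_add,
    Multiset.toFinsupp_singleton, Multiset.toFinsupp_singleton]

/-! ### G2: the weight and its decoding -/

/-- the LEMMA B weight on `4 × 4`: `w(x_{ρc}) = 2^ρ + 16·2^c` -/
def wK : Fin 4 × Fin 4 → ℕ := fun e => 2 ^ (e.1 : ℕ) + 16 * 2 ^ (e.2 : ℕ)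

theorem pow_pair_decode : ∀ x y x' y' : Fin 4,
    2 ^ (x' : ℕ) + 2 ^ (y' : ℕ) = 2 ^ (x : ℕ) + 2 ^ (y : ℕ) →
      (x' = x ∧ y' = y) ∨ (x' = y ∧ y' = x) := by
  decide

theorem pow_pair_bounds : ∀ x y : Fin 4,
    2 ≤ 2 ^ (x : ℕ) + 2 ^ (y : ℕ) ∧ 2 ^ (x : ℕ) + 2 ^ (y : ℕ) ≤ 16 := by
  decide

theorem wK_decode (a b a' b' : Fin 4 × Fin 4) (h : wK a' + wK b' = wK a + wK b) :
    ((a'.1 = a.1 ∧ b'.1 = b.1) ∨ (a'.1 = b.1 ∧ b'.1 = a.1)) ∧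
    ((a'.2 = a.2 ∧ b'.2 = b.2) ∨ (a'.2 = b.2 ∧ b'.2 = a.2)) := by
  simp only [wK] at h
  have hb1 := pow_pair_bounds a.1 b.1
  have hb2 := pow_pair_bounds a'.1 b'.1
  have hb3 := pow_pair_bounds a.2 b.2
  have hb4 := pow_pair_bounds a'.2 b'.2
  have hrows : 2 ^ (a'.1 : ℕ) + 2 ^ (b'.1 : ℕ) = 2 ^ (a.1 : ℕ) + 2 ^ (b.1 : ℕ) := by omega
  have hcols : 2 ^ (a'.2 : ℕ) + 2 ^ (b'.2 : ℕ) = 2 ^ (a.2 : ℕ) + 2 ^ (b.2 : ℕ) := by omega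
  exact ⟨pow_pair_decode _ _ _ _ hrows, pow_pair_decode _ _ _ _ hcols⟩

theorem weight_wK_pair (a b : Fin 4 × Fin 4) :
    weight wK (single a 1 + single b 1) = wK a + wK b := by
  simp [weight_single]

/-! ### G4: `singPermIdeal ℂ 4` is closed under `wK`-components -/

theorem IsWeightedHomogeneous.pderiv_nat {σ : Type*} {w : σ → ℕ} {φ : MvPolynomial σ ℂ} {n : ℕ}
    (h : IsWeightedHomogeneous w φ n) (e : σ) :
    IsWeightedHomogeneous w (pderiv e φ) (n - w e) := by
  classical
  intro d hd
  rw [coeff_pderiv] at hd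
  have h1 : coeff (d + Finsupp.single e 1) φ ≠ 0 := fun h0 => hd (by rw [h0, zero_mul])
  have h2 := h h1
  rw [map_add, weight_single, one_smul] at h2
  omega

theorem weight_wK_permMonomial (ρ : Equiv.Perm (Fin 4)) : weight wK (permMonomial ρ) = 255 := by
  simp only [permMonomial, map_sum, weight_single, one_smul, wK]
  rw [Finset.sum_add_distrib, Equiv.sum_comp ρ (fun j : Fin 4 => 2 ^ (j : ℕ))]
  simp [Fin.sum_univ_four]

theorem perPoly_isWeightedHomogeneous_wK : IsWeightedHomogeneous wK (perPoly (Fin 4) ℂ) 255 := by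
  rw [perPoly_eq_sum_monomial]
  exact IsWeightedHomogeneous.sum _ _ _ fun ρ _ =>
    isWeightedHomogeneous_monomial _ _ _ (weight_wK_permMonomial ρ)

theorem singPermIdeal_wK_closed (m : ℕ) {f : R44} (hf : f ∈ VonZurGathen.singPermIdeal ℂ 4) :
    weightedHomogeneousComponent wK m f ∈ VonZurGathen.singPermIdeal ℂ 4 := by
  classical
  letI : GradedAlgebra (weightedHomogeneousSubmodule ℂ wK) := weightedGradedAlgebra ℂ wK
  have hI : (VonZurGathen.singPermIdeal ℂ 4).IsHomogeneous (weightedHomogeneousSubmodule ℂ wK) := by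
    unfold VonZurGathen.singPermIdeal
    refine Ideal.homogeneous_span _ _ fun x hx => ?_
    rcases hx with rfl | ⟨ij, rfl⟩
    · exact ⟨255, (mem_weightedHomogeneousSubmodule ℂ wK 255 _).2 perPoly_isWeightedHomogeneous_wK⟩
    · exact ⟨255 - wK ij, (mem_weightedHomogeneousSubmodule ℂ wK (255 - wK ij) _).2
        (IsWeightedHomogeneous.pderiv_nat perPoly_isWeightedHomogeneous_wK ij)⟩
  exact weightedHomogeneousComponent_mem_of_mem ℂ wK hI hf m

/-! ### G5: minimality -/

theorem mem_minimalPrimes_singPermIdeal (P : Ideal R44) [hP : P.IsPrime]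
    (hle : VonZurGathen.singPermIdeal ℂ 4 ≤ P) (h8 : P.height ≤ 8) :
    P ∈ (VonZurGathen.singPermIdeal ℂ 4).minimalPrimes := by
  refine ⟨⟨hP, hle⟩, fun Q ⟨hQ, hIQ⟩ hQP => ?_⟩
  by_contra hne
  have hlt : Q < P := lt_of_le_of_ne hQP (fun h => hne (h ▸ le_rfl))
  haveI := hQ
  haveI : P.FiniteHeight := P.finiteHeight_iff.mpr (Or.inr (by
    intro htop; rw [htop] at h8; exact absurd h8 (by simp)))
  have h1 := Ideal.height_strict_mono_of_isPrime_of_isPrime hlt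
  have h2 : (8 : ℕ∞) ≤ Q.height := by
    rw [← Summit.ValiantsHypothesis.ValiantsHypothesis.Theorems.PolyaContinuedLaplaceRigidity.SingCodim.height_singPermIdeal_four_complex]
    exact Ideal.height_mono hIQ
  exact absurd (h2.trans_lt (h1.trans_le h8)) (lt_irrefl _)

/-! ### G3: the grading stub -/

theorem monomial_pair_eq (u v : Fin 4 × Fin 4) (c : ℂ) :
    (monomial (single u 1 + single v 1) c : R44) = C c * (X u * X v) := by
  rw [monomial_single_add, pow_one, ← C_mul_X_eq_monomial]; ring

/-- **LEMMA B, grading half — PROVED (v6).**  If `P` (prime, height `≤ 8`, over `singPermIdeal ℂ 4`)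
contains no variable outside row `i` and no K8-binomial, then every homogeneous quadric of `P` lies in
`(x_e : e ∈ row i)`.  Proof: `singPermIdeal` is homogeneous for the ℕ-weight `wK(x_{ρc}) = 2^ρ + 16·2^c`
(`perPoly_isWeightedHomogeneous_wK`, `IsWeightedHomogeneous.pderiv_nat`), `P` is a minimal prime over it
(`mem_minimalPrimes_singPermIdeal`, from `height_singPermIdeal_four_complex = 8`), hence `wK`-closed
(`weightedHomogeneousComponent_mem_of_mem_minimalPrimes`); the `wK`-component of a quadric `f ∈ P`
through a monomial `x_a x_b` avoiding row `i` is supported on the (row-pair, column-pair) class of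
`x_a x_b` (`wK_decode`), i.e. it is `α·x_a x_b + β·x_{(a₁,b₂)} x_{(b₁,a₂)}`; primality + `hnoVar` +
`hnoBin` kill it, so no such monomial occurs and `f ∈ (x_{row i})` by `mem_ideal_span_X_image`.
(v5's registered stub `stub_kcore_grading`, now a theorem; `hrow` is kept for the interface only.)
[cite: Kirkup2008, Prop 11] -/
theorem kcore_grading (P : Ideal R44) [hP : P.IsPrime]
    (hle : VonZurGathen.singPermIdeal ℂ 4 ≤ P) (h8 : P.height ≤ 8) (i : Fin 4)
    (_hrow : ∀ j : Fin 4, (X (i, j) : R44) ∈ P)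
    (hnoVar : ∀ e : Fin 4 × Fin 4, e.1 ≠ i → (X e : R44) ∉ P)
    (hnoBin : ∀ ρ ρ' c c' : Fin 4, ρ ≠ i → ρ' ≠ i → ρ ≠ ρ' → c ≠ c' → ∀ γ : ℂ, γ ≠ 0 →
      (X (ρ, c) * X (ρ', c') - C γ * (X (ρ, c') * X (ρ', c)) : R44) ∉ P) :
    ∀ f ∈ P, f.IsHomogeneous 2 → f ∈ cellIdeal (rowCells i) := by
  classical
  intro f hf hhom
  rw [cellIdeal, mem_ideal_span_X_image]
  intro d hd
  by_contra hcon
  push Not at hcon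
  have hminP := mem_minimalPrimes_singPermIdeal P hle h8
  have hcompP : ∀ m : ℕ, weightedHomogeneousComponent wK m f ∈ P := fun m =>
    weightedHomogeneousComponent_mem_of_mem_minimalPrimes wK
      (fun m g hg => singPermIdeal_wK_closed m hg) hminP hf m
  have hd2 : weight (1 : Fin 4 × Fin 4 → ℕ) d = 2 := hhom (MvPolynomial.mem_support_iff.1 hd)
  obtain ⟨a, b, rfl⟩ := exists_pair_of_weight_one_eq_two d hd2
  have hrow_of : ∀ e : Fin 4 × Fin 4,
      (single a 1 + single b 1 : (Fin 4 × Fin 4) →₀ ℕ) e ≠ 0 → e.1 ≠ i := by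
    intro e he hei
    exact he (hcon e (by simp [rowCells, hei]))
  have ha : a.1 ≠ i := hrow_of a (by rw [Finsupp.add_apply, single_eq_same]; omega)
  have hb : b.1 ≠ i := hrow_of b (by rw [Finsupp.add_apply, single_eq_same]; omega)
  -- the `wK`-component of `f` through the monomial `x_a x_b`
  set m := wK a + wK b with hm
  set g := weightedHomogeneousComponent wK m f with hg
  have hgP : g ∈ P := hcompP m
  have hcg : ∀ d', coeff d' g = if weight wK d' = m then coeff d' f else 0 := fun d' => by
    rw [hg, coeff_weightedHomogeneousComponent]
  -- its support: the (row-pair, column-pair) class of `x_a x_b`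
  set dt : (Fin 4 × Fin 4) →₀ ℕ := single (a.1, b.2) 1 + single (b.1, a.2) 1 with hdt
  have hsupp : ∀ d' : (Fin 4 × Fin 4) →₀ ℕ, coeff d' g ≠ 0 →
      d' = single a 1 + single b 1 ∨ d' = dt := by
    intro d' hd'
    rw [hcg] at hd'
    split_ifs at hd' with hw
    · obtain ⟨a', b', rfl⟩ := exists_pair_of_weight_one_eq_two d' (hhom hd')
      rw [weight_wK_pair] at hw
      obtain ⟨hr, hc⟩ := wK_decode a b a' b' hw
      rcases hr with ⟨h1, h2⟩ | ⟨h1, h2⟩ <;> rcases hc with ⟨h3, h4⟩ | ⟨h3, h4⟩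
      · left
        rw [show a' = a from Prod.ext h1 h3, show b' = b from Prod.ext h2 h4]
      · right
        rw [show a' = (a.1, b.2) from Prod.ext h1 h3, show b' = (b.1, a.2) from Prod.ext h2 h4]
      · right
        rw [show a' = (b.1, a.2) from Prod.ext h1 h3, show b' = (a.1, b.2) from Prod.ext h2 h4,
          add_comm]
      · left
        rw [show a' = b from Prod.ext h1 h3, show b' = a from Prod.ext h2 h4, add_comm]
    · exact absurd rfl hd'
  -- a nonzero scalar multiple of `x_a x_b` in `P` is impossible
  have hmono : ∀ c : ℂ, c ≠ 0 → (monomial (single a 1 + single b 1) c : R44) ∈ P → False := by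
    intro c hc hmem
    rw [monomial_pair_eq] at hmem
    have h1 : (X a * X b : R44) ∈ P := by
      rcases hP.mem_or_mem hmem with h | h
      · exact absurd (P.eq_top_of_isUnit_mem h ((IsUnit.mk0 c hc).map C)) hP.ne_top
      · exact h
    rcases hP.mem_or_mem h1 with h | h
    · exact hnoVar a ha h
    · exact hnoVar b hb h
  have hα : coeff (single a 1 + single b 1) f ≠ 0 := MvPolynomial.mem_support_iff.1 hd
  have hcd : coeff (single a 1 + single b 1) g = coeff (single a 1 + single b 1) f := by
    rw [hcg, if_pos (by rw [weight_wK_pair])]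
  by_cases hdeg : a.1 = b.1 ∨ a.2 = b.2
  · -- one monomial in the class
    have hdt_eq : dt = single a 1 + single b 1 := by
      rcases hdeg with h | h
      · have e1 : ((a.1, b.2) : Fin 4 × Fin 4) = b := Prod.ext h rfl
        have e2 : ((b.1, a.2) : Fin 4 × Fin 4) = a := Prod.ext h.symm rfl
        rw [hdt, e1, e2, add_comm]
      · have e1 : ((a.1, b.2) : Fin 4 × Fin 4) = a := Prod.ext rfl h.symm
        have e2 : ((b.1, a.2) : Fin 4 × Fin 4) = b := Prod.ext rfl h
        rw [hdt, e1, e2]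
    have hs : g.support ⊆ {single a 1 + single b 1} := by
      intro v hv
      rcases hsupp v (MvPolynomial.mem_support_iff.1 hv) with h | h
      · simp [h]
      · simp [h, hdt_eq]
    have hg_eq : g = monomial (single a 1 + single b 1) (coeff (single a 1 + single b 1) f) := by
      conv_lhs => rw [g.as_sum, Finset.sum_subset hs (fun v _ hv => by
        rw [MvPolynomial.notMem_support_iff.1 hv, map_zero]), Finset.sum_singleton]
      rw [hcd]
    exact hmono _ hα (hg_eq ▸ hgP)
  · -- a genuine binomial class
    push Not at hdeg
    obtain ⟨h1, h2⟩ := hdeg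
    have hne : single a 1 + single b 1 ≠ dt := by
      intro h
      have := Finsupp.ext_iff.1 h a
      have e1 : a ≠ ((a.1, b.2) : Fin 4 × Fin 4) := fun e => h2 (by
        have := congrArg Prod.snd e; simpa using this)
      have e2 : a ≠ ((b.1, a.2) : Fin 4 × Fin 4) := fun e => h1 (by
        have := congrArg Prod.fst e; simpa using this)
      simp only [hdt, Finsupp.add_apply, single_eq_same, single_eq_of_ne e1, single_eq_of_ne e2]
        at this
      omega
    have hwdt : weight wK dt = m := by
      rw [hdt, weight_wK_pair, hm]
      simp only [wK]
      ring
    set α := coeff (single a 1 + single b 1) f with hαd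
    set β := coeff dt f with hβd
    have hcdt : coeff dt g = β := by rw [hcg, if_pos hwdt]
    have hs : g.support ⊆ {single a 1 + single b 1, dt} := by
      intro v hv
      rcases hsupp v (MvPolynomial.mem_support_iff.1 hv) with h | h <;> simp [h]
    have hg_eq : g = monomial (single a 1 + single b 1) α + monomial dt β := by
      conv_lhs => rw [g.as_sum, Finset.sum_subset hs (fun v _ hv => by
        rw [MvPolynomial.notMem_support_iff.1 hv, map_zero]), Finset.sum_pair hne]
      rw [hcd, hcdt]
    by_cases hβ : β = 0
    · refine hmono α hα ?_
      have : g = monomial (single a 1 + single b 1) α := by rw [hg_eq, hβ, map_zero, add_zero]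
      exact this ▸ hgP
    · have key : C α⁻¹ * g =
          X a * X b + C (β / α) * (X (a.1, b.2) * X (b.1, a.2)) := by
        rw [hg_eq, hdt, monomial_pair_eq, monomial_pair_eq, mul_add, div_eq_mul_inv, mul_comm β]
        simp only [← mul_assoc, ← C_mul, inv_mul_cancel₀ hα, C_1, one_mul]
      have hmem : (C α⁻¹ * g : R44) ∈ P := P.mul_mem_left _ hgP
      rw [key] at hmem
      have hmem' : (X (a.1, a.2) * X (b.1, b.2) - C (-(β / α)) * (X (a.1, b.2) * X (b.1, a.2)) : R44)
          ∈ P := by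
        rw [map_neg, neg_mul, sub_neg_eq_add]
        exact hmem
      exact hnoBin a.1 b.1 a.2 b.2 ha hb h1 h2 (-(β / α)) (by simp [hα, hβ]) hmem'

end GradingMachinery

/-- Stub B-K7 («T7»; v8.1: a THEOREM by name — 17819-w1 g2's `SingCodim.kcore_noVar`, p627865 over
p626822).  In the K-core — `P` a prime of height `≤ 8` over `singPermIdeal ℂ 4` containing row `i`, no
other row and no column — NO variable outside row `i` lies in `P` (generic point: `u_c = 0` and the octic
`h = 0` are independent relations, `trdeg ≤ 7`, absurd).  [cite: Kirkup2008, Thm 14 / Prop 11] -/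
theorem stub_kcore_noVar (P : Ideal (MvPolynomial (Fin 4 × Fin 4) ℂ)) [P.IsPrime]
    (hle : VonZurGathen.singPermIdeal ℂ 4 ≤ P) (h8 : P.height ≤ 8) (i : Fin 4)
    (hrow : ∀ j : Fin 4, (X (i, j) : MvPolynomial (Fin 4 × Fin 4) ℂ) ∈ P)
    (hnorow : ∀ i' : Fin 4, i' ≠ i → ∃ j : Fin 4, (X (i', j) : MvPolynomial (Fin 4 × Fin 4) ℂ) ∉ P)
    (hnocol : ∀ c : Fin 4, ∃ r : Fin 4, (X (r, c) : MvPolynomial (Fin 4 × Fin 4) ℂ) ∉ P) :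
    ∀ e : Fin 4 × Fin 4, e.1 ≠ i → (X e : MvPolynomial (Fin 4 × Fin 4) ℂ) ∉ P := by
  exact Theorems.PolyaContinuedLaplaceRigidity.SingCodim.kcore_noVar P hle h8 i hrow hnorow hnocol

/-- Stub B-K8 («T8»; v8.1: a THEOREM by name — 17819-w1 g2's `SingCodim.kcore_noBinomial`, p627865 over
p627111).  In the K-core no binomial
`x_{ρc} x_{ρ'c'} − γ · x_{ρc'} x_{ρ'c}` (`ρ ≠ ρ'` off row `i`, `c ≠ c'`, `γ ≠ 0`) lies in `P`
(column-`c'` homogeneity: `h(col c' ↦ (u_c, γ v_c)) ≢ 0`, witnesses `Cert.lemmaB_witness` /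
`Cert.lemmaB_witness_one`, so `trdeg ≤ 7`, absurd).  [cite: Kirkup2008, Prop 11] -/
theorem stub_kcore_noBinomial (P : Ideal (MvPolynomial (Fin 4 × Fin 4) ℂ)) [P.IsPrime]
    (hle : VonZurGathen.singPermIdeal ℂ 4 ≤ P) (h8 : P.height ≤ 8) (i : Fin 4)
    (hrow : ∀ j : Fin 4, (X (i, j) : MvPolynomial (Fin 4 × Fin 4) ℂ) ∈ P)
    (hnorow : ∀ i' : Fin 4, i' ≠ i → ∃ j : Fin 4, (X (i', j) : MvPolynomial (Fin 4 × Fin 4) ℂ) ∉ P)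
    (hnocol : ∀ c : Fin 4, ∃ r : Fin 4, (X (r, c) : MvPolynomial (Fin 4 × Fin 4) ℂ) ∉ P) :
    ∀ ρ ρ' c c' : Fin 4, ρ ≠ i → ρ' ≠ i → ρ ≠ ρ' → c ≠ c' → ∀ γ : ℂ, γ ≠ 0 →
      (X (ρ, c) * X (ρ', c') - C γ * (X (ρ, c') * X (ρ', c)) : MvPolynomial (Fin 4 × Fin 4) ℂ) ∉ P := by
  exact Theorems.PolyaContinuedLaplaceRigidity.SingCodim.kcore_noBinomial P hle h8 i hrow hnorow hnocol

/-- **B-row from the K-core stubs** (sorry-free glue; types (L) and (X) by 17819-w1 g2's p624852). -/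
theorem rowPrimeRigidity_of_kcore : RowPrimeRigidity := by
  classical
  intro P hP hle h8 i hrow
  haveI := hP
  by_cases hrow' : ∃ i' : Fin 4, i' ≠ i ∧ ∀ j : Fin 4, (X (i', j) : MvPolynomial (Fin 4 × Fin 4) ℂ) ∈ P
  · obtain ⟨i', hne, hi'⟩ := hrow'
    refine Or.inr ⟨i', fun h => hne h.symm, ?_⟩
    exact Theorems.PolyaContinuedLaplaceRigidity.SingCodim.eq_span_X_twoRows ℂ
      (fun h => hne h.symm) P h8 hrow hi'
  by_cases hcol : ∃ c : Fin 4, ∀ r : Fin 4, (X (r, c) : MvPolynomial (Fin 4 × Fin 4) ℂ) ∈ P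
  · obtain ⟨c, hc⟩ := hcol
    refine Or.inl ⟨c, fun f hf hhom => ?_⟩
    have hle' : BoraleviCarliniMichalekVentura2025.subpermIdeal ℂ 4 4 3 ≤ P := by
      have h := BoraleviCarliniMichalekVentura2025.singPermIdeal_eq_subpermIdeal ℂ (m := 4) (by norm_num)
      rw [h] at hle
      exact hle
    exact Theorems.PolyaContinuedLaplaceRigidity.SingCodim.quadric_mem_span_rowCol ℂ i c P hle' h8
      hrow hc f hf hhom
  · push Not at hrow' hcol
    have hnv := stub_kcore_noVar P hle h8 i hrow hrow' hcol
    have hnb := stub_kcore_noBinomial P hle h8 i hrow hrow' hcol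
    refine Or.inl ⟨0, fun f hf hhom => ?_⟩
    have hf' := kcore_grading P hle h8 i hrow hnv hnb f hf hhom
    exact Ideal.span_mono (Set.image_mono (Finset.coe_subset.2 (rowCells_subset_rowCol i 0))) hf'

theorem stub_rowPrimeRigidity : RowPrimeRigidity :=
  rowPrimeRigidity_of_kcore

/-! ## Transport: the column stub from the row stub via the transpose automorphism `x_{ij} ↦ x_{ji}` -/

/-- The transpose of the variable matrix, as a ring automorphism of `ℂ[x_{4×4}]`. -/
def tr : MvPolynomial (Fin 4 × Fin 4) ℂ ≃+* MvPolynomial (Fin 4 × Fin 4) ℂ :=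
  (MvPolynomial.renameEquiv ℂ (Equiv.prodComm (Fin 4) (Fin 4))).toRingEquiv

theorem tr_apply (f : MvPolynomial (Fin 4 × Fin 4) ℂ) : tr f = rename Prod.swap f := rfl

theorem tr_X (e : Fin 4 × Fin 4) : tr (X e : MvPolynomial (Fin 4 × Fin 4) ℂ) = X e.swap := by
  rw [tr_apply, rename_X]

theorem tr_tr (f : MvPolynomial (Fin 4 × Fin 4) ℂ) : tr (tr f) = f := by
  rw [tr_apply, tr_apply, rename_rename, Prod.swap_swap_eq, rename_id]
  rfl

/-- `tr` fixes the generic permanent (same proof as the tree's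
`…ValuativeGCTValuativeFlipTangentRank.tr_rename_swap_perPoly` / `…PolyaContinuedMonotoneCoverHard.perPoly_rename_swap`,
re-proved to keep the import list short). [folklore] -/
theorem tr_perPoly : tr (perPoly (Fin 4) ℂ) = perPoly (Fin 4) ℂ := by
  rw [tr_apply]
  have h : rename (Prod.swap : Fin 4 × Fin 4 → Fin 4 × Fin 4) (perPoly (Fin 4) ℂ) =
      ((Matrix.mvPolynomialX (Fin 4) (Fin 4) ℂ).transpose).permanent := by
    simp [perPoly, Matrix.permanent, map_sum, map_prod, Matrix.mvPolynomialX, rename_X]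
  rw [h, Matrix.permanent_transpose]
  rfl

theorem tr_pderiv (e : Fin 4 × Fin 4) (f : MvPolynomial (Fin 4 × Fin 4) ℂ) :
    tr (pderiv e f) = pderiv e.swap (tr f) := by
  rw [tr_apply, tr_apply, pderiv_rename Prod.swap_injective]

/-- `singPermIdeal ℂ 4` is carried into any ideal containing it by `tr`. -/
theorem singPermIdeal_le_comap_tr {P : Ideal (MvPolynomial (Fin 4 × Fin 4) ℂ)}
    (h : VonZurGathen.singPermIdeal ℂ 4 ≤ P) : VonZurGathen.singPermIdeal ℂ 4 ≤ P.comap tr := by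
  unfold VonZurGathen.singPermIdeal
  rw [Ideal.span_le]
  rintro g hg
  rw [SetLike.mem_coe, Ideal.mem_comap]
  rcases hg with rfl | ⟨e, rfl⟩
  · rw [tr_perPoly]; exact h (VonZurGathen.perPoly_mem_singPermIdeal ℂ 4)
  · rw [tr_pderiv, tr_perPoly]
    exact h (Ideal.subset_span (Set.mem_insert_of_mem _ ⟨e.swap, rfl⟩))

/-- `tr` maps the variable ideal of a cell set to that of the transposed cell set. -/
theorem map_tr_cellIdeal (S : Finset (Fin 4 × Fin 4)) :
    (cellIdeal S).map tr = cellIdeal (S.image Prod.swap) := by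
  unfold cellIdeal
  rw [Ideal.map_span, ← Set.image_comp, Finset.coe_image, ← Set.image_comp]
  congr 1
  ext f
  simp only [Set.mem_image, Function.comp_apply]
  constructor
  · rintro ⟨e, he, rfl⟩; exact ⟨e, he, (tr_X e).symm⟩
  · rintro ⟨e, he, rfl⟩; exact ⟨e, he, tr_X e⟩

theorem image_swap_rowCol (i c : Fin 4) : (rowCol i c).image Prod.swap = rowCol c i := by
  ext e
  simp only [rowCol, Finset.mem_image, Finset.mem_filter, Finset.mem_univ, true_and]
  constructor
  · rintro ⟨e', h, rfl⟩; simpa [or_comm] using h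
  · intro h; exact ⟨e.swap, by simpa [or_comm] using h, Prod.swap_swap e⟩

theorem image_swap_twoRows (i i' : Fin 4) : (twoRows i i').image Prod.swap = twoCols i i' := by
  ext e
  simp only [twoRows, twoCols, Finset.mem_image, Finset.mem_filter, Finset.mem_univ, true_and]
  constructor
  · rintro ⟨e', h, rfl⟩; simpa using h
  · intro h; exact ⟨e.swap, by simpa using h, Prod.swap_swap e⟩

/-- **B-col from B-row** by transposition. -/
theorem colPrimeRigidity_of_row (hr : RowPrimeRigidity) : ColPrimeRigidity := by
  intro P hP hle h8 c hcol
  haveI := hP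
  -- the transposed prime
  have hQP : (P.comap tr).IsPrime := Ideal.comap_isPrime tr P
  have hQle : VonZurGathen.singPermIdeal ℂ 4 ≤ P.comap tr := singPermIdeal_le_comap_tr hle
  have hQ8 : (P.comap tr).height ≤ 8 := by rw [RingEquiv.height_comap]; exact h8
  have hrow : ∀ j : Fin 4, (X (c, j) : MvPolynomial (Fin 4 × Fin 4) ℂ) ∈ P.comap tr := by
    intro j; rw [Ideal.mem_comap, tr_X]; exact hcol j
  rcases hr (P.comap tr) hQP hQle hQ8 c hrow with ⟨c', h⟩ | ⟨i', hci', h⟩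
  · refine Or.inl ⟨c', fun f hf hf2 => ?_⟩
    have htf : tr f ∈ P.comap tr := by rw [Ideal.mem_comap, tr_tr]; exact hf
    have htf2 : (tr f).IsHomogeneous 2 := by rw [tr_apply]; exact hf2.rename_isHomogeneous
    have hmem := Ideal.mem_map_of_mem tr (h (tr f) htf htf2)
    rwa [tr_tr, map_tr_cellIdeal, image_swap_rowCol] at hmem
  · refine Or.inr ⟨i', hci', ?_⟩
    have := congrArg (Ideal.map tr) h
    rwa [Ideal.map_comap_of_surjective _ tr.surjective, map_tr_cellIdeal, image_swap_twoRows] at this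

/-- B-col is a THEOREM given B-row (v4). -/
theorem stub_colPrimeRigidity : ColPrimeRigidity :=
  colPrimeRigidity_of_row stub_rowPrimeRigidity


/-- B = (zero line, LANDED: 17819-w1 g2 `…SingCodim.row_or_col_subset_of_singPermIdeal_four_le`,
p623618) + B-row + B-col.  Sorry-free glue. -/
theorem topPrimeRigidity_of : RowPrimeRigidity → ColPrimeRigidity → TopPrimeRigidity := by
  intro hr hc P hP hle h8
  haveI := hP
  rcases Theorems.PolyaContinuedLaplaceRigidity.SingCodim.row_or_col_subset_of_singPermIdeal_four_le
      ℂ (by norm_num) (by norm_num) P hle h8 with ⟨i, hi⟩ | ⟨c, hcol⟩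
  · rcases hr P hP hle h8 i hi with ⟨c, h⟩ | ⟨i', hii', h⟩
    · exact Or.inl ⟨i, c, h⟩
    · exact Or.inr ⟨i, i', hii', Or.inl h⟩
  · rcases hc P hP hle h8 c hcol with ⟨i, h⟩ | ⟨c', hcc', h⟩
    · exact Or.inl ⟨i, c, h⟩
    · exact Or.inr ⟨c, c', hcc', Or.inr h⟩

/-- Stub B of v1/v2 is now a theorem of the two smaller stubs. -/
theorem stub_topPrimeRigidity : TopPrimeRigidity :=
  topPrimeRigidity_of stub_rowPrimeRigidity stub_colPrimeRigidity

/-! ## Glue, part 1 — `S`-order ideals and the permutation monomial through a cell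
(everything below is sorry-free) -/

/-- The `S`-degree of an exponent vector: total exponent carried by the cells of `S`. -/
def sdeg (S : Finset (Fin 4 × Fin 4)) (m : (Fin 4 × Fin 4) →₀ ℕ) : ℕ := ∑ e ∈ S, m e

theorem sdeg_add (S : Finset (Fin 4 × Fin 4)) (a b : (Fin 4 × Fin 4) →₀ ℕ) :
    sdeg S (a + b) = sdeg S a + sdeg S b := by
  simp [sdeg, Finset.sum_add_distrib]

/-- Polynomials all of whose monomials have `S`-degree at least `k` (an ideal). -/
def sdegIdeal (S : Finset (Fin 4 × Fin 4)) (k : ℕ) : Ideal (MvPolynomial (Fin 4 × Fin 4) ℂ) where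
  carrier := {f | ∀ m ∈ f.support, k ≤ sdeg S m}
  zero_mem' := by simp
  add_mem' := by
    intro f g hf hg m hm
    rcases Finset.mem_union.1 (MvPolynomial.support_add hm) with h | h
    exacts [hf m h, hg m h]
  smul_mem' := by
    intro g f hf m hm
    rw [smul_eq_mul] at hm
    obtain ⟨a, -, b, hb, rfl⟩ := Finset.mem_add.1 (MvPolynomial.support_mul g f hm)
    rw [sdeg_add]
    exact le_add_left (hf b hb)

theorem mem_sdegIdeal {S : Finset (Fin 4 × Fin 4)} {k : ℕ} {f : MvPolynomial (Fin 4 × Fin 4) ℂ} :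
    f ∈ sdegIdeal S k ↔ ∀ m ∈ f.support, k ≤ sdeg S m := Iff.rfl

theorem X_mem_sdegIdeal {S : Finset (Fin 4 × Fin 4)} {e : Fin 4 × Fin 4} (he : e ∈ S) :
    (X e : MvPolynomial (Fin 4 × Fin 4) ℂ) ∈ sdegIdeal S 1 := by
  intro m hm
  rw [MvPolynomial.support_X, Finset.mem_singleton] at hm
  subst hm
  unfold sdeg
  rw [Finset.sum_eq_single_of_mem e he]
  · simp
  · intro b _ hb
    simp [Ne.symm hb]

theorem cellIdeal_le_sdegIdeal (S : Finset (Fin 4 × Fin 4)) : cellIdeal S ≤ sdegIdeal S 1 := by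
  unfold cellIdeal
  rw [Ideal.span_le]
  rintro _ ⟨e, he, rfl⟩
  exact X_mem_sdegIdeal (Finset.mem_coe.1 he)

theorem sdegIdeal_mul_le (S : Finset (Fin 4 × Fin 4)) (k l : ℕ) :
    sdegIdeal S k * sdegIdeal S l ≤ sdegIdeal S (k + l) := by
  rw [Ideal.mul_le]
  intro f hf g hg m hm
  obtain ⟨a, ha, b, hb, rfl⟩ := Finset.mem_add.1 (MvPolynomial.support_mul f g hm)
  rw [sdeg_add]
  exact add_le_add (hf a ha) (hg b hb)

/-- The permutation monomial of the transposition `(c i)` passes through the cell `(i, c)` and meets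
row `i` ∪ column `c` exactly once. -/
theorem sdeg_rowCol_permMonomial_swap (i c : Fin 4) :
    sdeg (rowCol i c) (permMonomial (Equiv.swap c i)) = 1 := by
  unfold sdeg rowCol
  rw [Finset.sum_filter, Fintype.sum_prod_type]
  simp only [permMonomial_apply, Equiv.swap_apply_def]
  fin_cases i <;> fin_cases c <;> simp +decide

/-- `per₄ ∉` {polynomials of (row `i` ∪ col `c`)-order ≥ 2}; in particular `per₄ ∉ (x_{row i ∪ col c})²`. -/
theorem perPoly_not_mem_sdegIdeal_rowCol (i c : Fin 4) :
    perPoly (Fin 4) ℂ ∉ sdegIdeal (rowCol i c) 2 := by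
  intro h
  have hmem : permMonomial (Equiv.swap c i) ∈ (perPoly (Fin 4) ℂ).support := by
    rw [MvPolynomial.mem_support_iff, coeff_permMonomial_perPoly]
    exact one_ne_zero
  have h2 := h _ hmem
  rw [sdeg_rowCol_permMonomial_swap] at h2
  omega

/-! ## Stub C (v7 re-cut; v8: PROVED end to end): C-i (bidegree reduction), C-ii (minimal primes of the
bilinear ideal are two-line ideals, GIVEN B) and C-iii-a (common zeros lie in two-line coordinate spaces)
are PROVED below; the two-columns case is transported to two rows by `tr`; the ONE remaining C-stub is the
bad point `stub_twoRows_badPoint` (pure linear algebra on an explicit `8 × 8` system, no rigidity input). -/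

section StubC
open Finsupp

/-! ### C-i: the bidegree reduction -/

/-- the indicator weight of a cell set `S` -/
def wS (S : Finset (Fin 4 × Fin 4)) : Fin 4 × Fin 4 → ℕ := fun e => if e ∈ S then 1 else 0

theorem wS_le_one (S : Finset (Fin 4 × Fin 4)) (e : Fin 4 × Fin 4) : wS S e ≤ 1 := by
  unfold wS; split_ifs <;> simp

/-- the `S`-weight of an exponent vector is at most its degree -/
theorem weight_wS_le_weight_one (S : Finset (Fin 4 × Fin 4)) (d : Fin 4 × Fin 4 →₀ ℕ) :
    weight (wS S) d ≤ weight (1 : Fin 4 × Fin 4 → ℕ) d := by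
  simp only [weight_apply, Finsupp.sum, smul_eq_mul, Pi.one_apply, mul_one]
  exact Finset.sum_le_sum fun e _ => by
    calc d e * wS S e ≤ d e * 1 := Nat.mul_le_mul_left _ (wS_le_one S e)
      _ = d e := mul_one _

/-- an exponent vector meeting `S` has positive `S`-weight -/
theorem weight_wS_pos {S : Finset (Fin 4 × Fin 4)} {d : Fin 4 × Fin 4 →₀ ℕ} {e : Fin 4 × Fin 4}
    (he : e ∈ S) (hde : d e ≠ 0) : 1 ≤ weight (wS S) d := by
  simp only [weight_apply, Finsupp.sum, smul_eq_mul]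
  have hmem : e ∈ d.support := Finsupp.mem_support_iff.2 hde
  calc 1 ≤ d e * wS S e := by
          have : wS S e = 1 := by simp [wS, he]
          rw [this, mul_one]; exact Nat.one_le_iff_ne_zero.2 hde
    _ ≤ ∑ x ∈ d.support, d x * wS S x :=
          Finset.single_le_sum (f := fun x => d x * wS S x) (fun _ _ => Nat.zero_le _) hmem

/-- every permutation monomial meets two rows in exactly two cells -/
theorem weight_wS_twoRows_permMonomial {i i' : Fin 4} (hii' : i ≠ i') (ρ : Equiv.Perm (Fin 4)) :
    weight (wS (twoRows i i')) (permMonomial ρ) = 2 := by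
  simp only [permMonomial, map_sum, weight_single, one_smul, wS, twoRows, Finset.mem_filter,
    Finset.mem_univ, true_and]
  rw [Equiv.sum_comp ρ (fun r : Fin 4 => if r = i ∨ r = i' then 1 else 0), Finset.sum_boole]
  have : (Finset.univ.filter fun r : Fin 4 => r = i ∨ r = i') = {i, i'} := by
    ext r; simp
  rw [this, Finset.card_pair hii']; rfl

/-- every permutation monomial meets two columns in exactly two cells -/
theorem weight_wS_twoCols_permMonomial {j j' : Fin 4} (hjj' : j ≠ j') (ρ : Equiv.Perm (Fin 4)) :
    weight (wS (twoCols j j')) (permMonomial ρ) = 2 := by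
  simp only [permMonomial, map_sum, weight_single, one_smul, wS, twoCols, Finset.mem_filter,
    Finset.mem_univ, true_and]
  rw [Finset.sum_boole]
  have : (Finset.univ.filter fun r : Fin 4 => r = j ∨ r = j') = {j, j'} := by
    ext r; simp
  rw [this, Finset.card_pair hjj']; rfl

/-- `per₄` is `wS`-homogeneous of weight `2` for any two-line cell set -/
theorem perPoly_isWeightedHomogeneous_wS {i i' : Fin 4} (hii' : i ≠ i') (S : Finset (Fin 4 × Fin 4))
    (hS : S = twoRows i i' ∨ S = twoCols i i') :
    IsWeightedHomogeneous (wS S) (perPoly (Fin 4) ℂ) 2 := by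
  rw [perPoly_eq_sum_monomial]
  refine IsWeightedHomogeneous.sum _ _ _ fun ρ _ => isWeightedHomogeneous_monomial _ _ _ ?_
  rcases hS with rfl | rfl
  · exact weight_wS_twoRows_permMonomial hii' ρ
  · exact weight_wS_twoCols_permMonomial hii' ρ

/-- a degree-2 form in the ideal of the variables of `S` is the sum of its `S`-weight-1 and
`S`-weight-2 components -/
theorem eq_comp_one_add_comp_two (S : Finset (Fin 4 × Fin 4)) {f : R44} (hf : f ∈ cellIdeal S)
    (hhom : f.IsHomogeneous 2) :
    f = weightedHomogeneousComponent (wS S) 1 f + weightedHomogeneousComponent (wS S) 2 f := by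
  classical
  rw [cellIdeal, mem_ideal_span_X_image] at hf
  ext d
  rw [coeff_add, coeff_weightedHomogeneousComponent, coeff_weightedHomogeneousComponent]
  by_cases hd : coeff d f = 0
  · simp [hd]
  · have hsupp : d ∈ f.support := MvPolynomial.mem_support_iff.2 hd
    obtain ⟨e, he, hde⟩ := hf d hsupp
    have h1 : 1 ≤ weight (wS S) d := weight_wS_pos he hde
    have h2 : weight (wS S) d ≤ 2 := by
      have := weight_wS_le_weight_one S d
      rw [hhom hd] at this; exact this
    interval_cases h : weight (wS S) d <;> simp

/-- **C-i (bidegree reduction), PROVED.**  A width-4 decomposition of `per₄` with all eight quadrics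
in the ideal of two lines `S` (two rows or two columns) can be replaced by one whose quadrics are
`S`-BILINEAR (`wS`-weight `1`, degree `2`): take the `wS`-weight-1 components.  Reason: each quadric
is (weight 1) + (weight 2) (no weight-0 part, being in `(x_S)`), the product of two such has its
weight-2 part equal to the product of the weight-1 parts, and `per₄` is pure of weight 2. -/
theorem twoLine_bilinear_reduction {i i' : Fin 4} (hii' : i ≠ i') (S : Finset (Fin 4 × Fin 4))
    (hS : S = twoRows i i' ∨ S = twoCols i i') (p q : Fin 4 → R44)
    (hp : ∀ k, p k ∈ cellIdeal S) (hq : ∀ k, q k ∈ cellIdeal S)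
    (hp2 : ∀ k, (p k).IsHomogeneous 2) (hq2 : ∀ k, (q k).IsHomogeneous 2)
    (hper : perPoly (Fin 4) ℂ = ∑ k, p k * q k) :
    ∃ a b : Fin 4 → R44,
      (∀ k, IsWeightedHomogeneous (wS S) (a k) 1 ∧ (a k).IsHomogeneous 2 ∧
            IsWeightedHomogeneous (wS S) (b k) 1 ∧ (b k).IsHomogeneous 2) ∧
      perPoly (Fin 4) ℂ = ∑ k, a k * b k := by
  classical
  set a : Fin 4 → R44 := fun k => weightedHomogeneousComponent (wS S) 1 (p k) with ha
  set b : Fin 4 → R44 := fun k => weightedHomogeneousComponent (wS S) 1 (q k) with hb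
  -- homogeneity of components of a homogeneous quadric
  have hcomp_hom : ∀ {f : R44}, f.IsHomogeneous 2 → ∀ m,
      (weightedHomogeneousComponent (wS S) m f).IsHomogeneous 2 := by
    intro f hf m d hd
    rw [coeff_weightedHomogeneousComponent] at hd
    split_ifs at hd with h
    · exact hf hd
    · exact absurd rfl hd
  refine ⟨a, b, fun k => ⟨weightedHomogeneousComponent_isWeightedHomogeneous 1 (p k),
    hcomp_hom (hp2 k) 1, weightedHomogeneousComponent_isWeightedHomogeneous 1 (q k),
    hcomp_hom (hq2 k) 1⟩, ?_⟩
  -- take the weight-2 component of `per₄ = Σ p q`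
  have hper2 : weightedHomogeneousComponent (wS S) 2 (perPoly (Fin 4) ℂ) = perPoly (Fin 4) ℂ :=
    (perPoly_isWeightedHomogeneous_wS hii' S hS).weightedHomogeneousComponent_same
  rw [← hper2, hper, map_sum]
  refine Finset.sum_congr rfl fun k _ => ?_
  -- decompose p k and q k
  set P1 := weightedHomogeneousComponent (wS S) 1 (p k)
  set P2 := weightedHomogeneousComponent (wS S) 2 (p k)
  set Q1 := weightedHomogeneousComponent (wS S) 1 (q k)
  set Q2 := weightedHomogeneousComponent (wS S) 2 (q k)
  have hP1 : IsWeightedHomogeneous (wS S) P1 1 := weightedHomogeneousComponent_isWeightedHomogeneous _ _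
  have hP2 : IsWeightedHomogeneous (wS S) P2 2 := weightedHomogeneousComponent_isWeightedHomogeneous _ _
  have hQ1 : IsWeightedHomogeneous (wS S) Q1 1 := weightedHomogeneousComponent_isWeightedHomogeneous _ _
  have hQ2 : IsWeightedHomogeneous (wS S) Q2 2 := weightedHomogeneousComponent_isWeightedHomogeneous _ _
  have hpk : p k = P1 + P2 := eq_comp_one_add_comp_two S (hp k) (hp2 k)
  have hqk : q k = P1 * 0 + (Q1 + Q2) := by rw [mul_zero, zero_add]; exact eq_comp_one_add_comp_two S (hq k) (hq2 k)
  rw [mul_zero, zero_add] at hqk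
  have hexp : p k * q k = P1 * Q1 + ((P1 * Q2 + P2 * Q1) + P2 * Q2) := by rw [hpk, hqk]; ring
  have h11 : IsWeightedHomogeneous (wS S) (P1 * Q1) 2 := hP1.mul hQ1
  have h3 : IsWeightedHomogeneous (wS S) (P1 * Q2 + P2 * Q1) 3 := (hP1.mul hQ2).add (hP2.mul hQ1)
  have h4 : IsWeightedHomogeneous (wS S) (P2 * Q2) 4 := hP2.mul hQ2
  rw [hexp, map_add, map_add, h11.weightedHomogeneousComponent_same,
    h3.weightedHomogeneousComponent_ne 2 (by norm_num),
    h4.weightedHomogeneousComponent_ne 2 (by norm_num), add_zero, add_zero]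


/-! ### C-ii: every minimal prime of a width-4 ideal `(a, b)` is a two-line ideal (given B) -/

/-- The ideal of a width-4 decomposition. -/
def decompIdeal (a b : Fin 4 → R44) : Ideal R44 :=
  Ideal.span ((Finset.univ.image a ∪ Finset.univ.image b : Finset R44) : Set R44)

theorem mem_decompIdeal_left (a b : Fin 4 → R44) (k : Fin 4) : a k ∈ decompIdeal a b :=
  Ideal.subset_span (Finset.mem_coe.2
    (Finset.mem_union_left _ (Finset.mem_image_of_mem a (Finset.mem_univ k))))

theorem mem_decompIdeal_right (a b : Fin 4 → R44) (k : Fin 4) : b k ∈ decompIdeal a b :=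
  Ideal.subset_span (Finset.mem_coe.2
    (Finset.mem_union_right _ (Finset.mem_image_of_mem b (Finset.mem_univ k))))

/-- **C-ii, PROVED.**  Given top-prime rigidity (B), every minimal prime of the ideal `(a_k, b_k)` of a
width-4 decomposition `per₄ = Σ a_k b_k` into homogeneous quadrics is the ideal of two rows or of two
columns: it has height `≤ 8` (Krull) and contains `singPermIdeal` (product rule), so B applies, and the
types (X)/(K) would put `per₄ ∈ (x_{row ∪ col})²`, which `perPoly_not_mem_sdegIdeal_rowCol` forbids. -/
theorem minimalPrimes_decompIdeal_twoLine (hB : TopPrimeRigidity) (a b : Fin 4 → R44)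
    (ha2 : ∀ k, (a k).IsHomogeneous 2) (hb2 : ∀ k, (b k).IsHomogeneous 2)
    (hper : perPoly (Fin 4) ℂ = ∑ k, a k * b k) {Q : Ideal R44}
    (hQ : Q ∈ (decompIdeal a b).minimalPrimes) :
    ∃ r r' : Fin 4, r ≠ r' ∧ (Q = cellIdeal (twoRows r r') ∨ Q = cellIdeal (twoCols r r')) := by
  classical
  have hScard : (Finset.univ.image a ∪ Finset.univ.image b : Finset R44).card ≤ 8 :=
    calc (Finset.univ.image a ∪ Finset.univ.image b).card
          ≤ (Finset.univ.image a).card + (Finset.univ.image b).card := Finset.card_union_le _ _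
      _ ≤ (Finset.univ : Finset (Fin 4)).card + (Finset.univ : Finset (Fin 4)).card :=
          add_le_add Finset.card_image_le Finset.card_image_le
      _ = 8 := by simp
  have hsing : singIdeal (perPoly (Fin 4) ℂ) ≤ decompIdeal a b :=
    Theorems.PolyaContinuedLaplaceRigidity.Strength.singIdeal_le_of_eq_sum_mul a b hper _
      (mem_decompIdeal_left a b) (mem_decompIdeal_right a b)
  have hQprime : Q.IsPrime := hQ.1.1
  have hIQ : decompIdeal a b ≤ Q := hQ.1.2
  have hQ8 : Q.height ≤ 8 :=
    (Ideal.height_le_card_of_mem_minimalPrimes_span_finset hQ).trans (by exact_mod_cast hScard)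
  have hsingQ : VonZurGathen.singPermIdeal ℂ 4 ≤ Q := by
    rw [← singIdeal_perPoly]
    exact hsing.trans hIQ
  rcases hB Q hQprime hsingQ hQ8 with ⟨i, c, h1⟩ | ⟨r, r', hrr', hP⟩
  · exfalso
    have ha' : ∀ k, a k ∈ sdegIdeal (rowCol i c) 1 := fun k =>
      cellIdeal_le_sdegIdeal _ (h1 _ (hIQ (mem_decompIdeal_left a b k)) (ha2 k))
    have hb' : ∀ k, b k ∈ sdegIdeal (rowCol i c) 1 := fun k =>
      cellIdeal_le_sdegIdeal _ (h1 _ (hIQ (mem_decompIdeal_right a b k)) (hb2 k))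
    refine perPoly_not_mem_sdegIdeal_rowCol i c ?_
    rw [hper]
    exact Ideal.sum_mem _ fun k _ => sdegIdeal_mul_le _ 1 1 (Ideal.mul_mem_mul (ha' k) (hb' k))
  · exact ⟨r, r', hrr', hP⟩

/-! ### C-iii-a: common zeros of `(a, b)` lie in two-line coordinate subspaces (given B) -/

/-- **C-iii-a, PROVED.**  Given B, a common zero `pt` of the eight quadrics of a width-4 decomposition
vanishes identically on two rows or on two columns: the prime `ker (eval pt)` contains `(a, b)`, hence
one of its minimal primes, which is a two-line variable ideal by C-ii. -/
theorem commonZero_twoLine (hB : TopPrimeRigidity) (a b : Fin 4 → R44)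
    (ha2 : ∀ k, (a k).IsHomogeneous 2) (hb2 : ∀ k, (b k).IsHomogeneous 2)
    (hper : perPoly (Fin 4) ℂ = ∑ k, a k * b k) (pt : Fin 4 × Fin 4 → ℂ)
    (hpt : ∀ k, eval pt (a k) = 0 ∧ eval pt (b k) = 0) :
    ∃ r r' : Fin 4, r ≠ r' ∧
      ((∀ c, pt (r, c) = 0 ∧ pt (r', c) = 0) ∨ (∀ ρ, pt (ρ, r) = 0 ∧ pt (ρ, r') = 0)) := by
  classical
  set K : Ideal R44 := RingHom.ker (eval pt) with hK
  haveI : K.IsPrime := RingHom.ker_isPrime _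
  have hIK : decompIdeal a b ≤ K := by
    unfold decompIdeal
    rw [Ideal.span_le]
    intro g hg
    rw [Finset.mem_coe, Finset.mem_union, Finset.mem_image, Finset.mem_image] at hg
    rw [SetLike.mem_coe, hK, RingHom.mem_ker]
    rcases hg with ⟨k, -, rfl⟩ | ⟨k, -, rfl⟩
    exacts [(hpt k).1, (hpt k).2]
  obtain ⟨Q, hQ, hQK⟩ := Ideal.exists_minimalPrimes_le hIK
  obtain ⟨r, r', hrr', hQeq⟩ := minimalPrimes_decompIdeal_twoLine hB a b ha2 hb2 hper hQ
  have hvan : ∀ T : Finset (Fin 4 × Fin 4), Q = cellIdeal T → ∀ e ∈ T, pt e = 0 := by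
    intro T hT e he
    have hX : (X e : R44) ∈ Q := by
      rw [hT]; exact Ideal.subset_span ⟨e, Finset.mem_coe.2 he, rfl⟩
    have := hQK hX
    rw [hK, RingHom.mem_ker, eval_X] at this
    exact this
  refine ⟨r, r', hrr', ?_⟩
  rcases hQeq with hQeq | hQeq
  · refine Or.inl fun c => ⟨hvan _ hQeq (r, c) ?_, hvan _ hQeq (r', c) ?_⟩ <;>
      simp [twoRows]
  · refine Or.inr fun ρ => ⟨hvan _ hQeq (ρ, r) ?_, hvan _ hQeq (ρ, r') ?_⟩ <;>
      simp [twoCols]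

/-! ### The bad point (C-iii-b) — PROVED in v8 (pure linear algebra, no B) -/

section BadPoint

/-! ### BP-0: the support of an `S`-bilinear quadric -/

/-- A monomial of an `S`-bilinear quadric (`wS`-weight 1, degree 2) is `x_e x_{e'}` with `e ∈ S`,
`e' ∉ S`. -/
theorem bilinear_support (S : Finset (Fin 4 × Fin 4)) {f : R44}
    (hw : IsWeightedHomogeneous (wS S) f 1) (h2 : f.IsHomogeneous 2) {d : Fin 4 × Fin 4 →₀ ℕ}
    (hd : coeff d f ≠ 0) : ∃ e ∈ S, ∃ e' ∉ S, d = single e 1 + single e' 1 := by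
  obtain ⟨a, b, rfl⟩ := exists_pair_of_weight_one_eq_two d (h2 hd)
  have h1 := hw hd
  simp only [map_add, weight_single, one_smul, wS] at h1
  by_cases ha : a ∈ S
  · by_cases hb : b ∈ S
    · simp [ha, hb] at h1
    · exact ⟨a, ha, b, hb, rfl⟩
  · by_cases hb : b ∈ S
    · exact ⟨b, hb, a, ha, add_comm _ _⟩
    · simp [ha, hb] at h1

/-! ### BP-1: expansion of an `S`-bilinear quadric -/

/-- An `S`-bilinear quadric is `Σ_{e ∈ S, e' ∉ S} c_{e e'} · x_e x_{e'}`. -/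
theorem bilinear_expand (S : Finset (Fin 4 × Fin 4)) {f : R44}
    (hw : IsWeightedHomogeneous (wS S) f 1) (h2 : f.IsHomogeneous 2) :
    f = ∑ e ∈ S, ∑ e' ∈ Sᶜ, C (coeff (single e 1 + single e' 1) f) * (X e * X e') := by
  classical
  ext d
  simp only [coeff_sum, ← monomial_pair_eq, coeff_monomial]
  by_cases hd : coeff d f = 0
  · rw [hd]
    symm
    refine Finset.sum_eq_zero fun e _ => Finset.sum_eq_zero fun e' _ => ?_
    split_ifs with h
    · rw [← h] at hd; exact hd
    · rfl
  · obtain ⟨e₀, he₀, e₀', he₀', rfl⟩ := bilinear_support S hw h2 hd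
    have he₀'c : e₀' ∈ Sᶜ := Finset.mem_compl.2 he₀'
    -- uniqueness of the representation
    have key : ∀ e ∈ S, ∀ e' ∈ Sᶜ, single e 1 + single e' 1 = single e₀ 1 + single e₀' 1 →
        e = e₀ ∧ e' = e₀' := by
      intro e he e' he' h
      rcases (Finsupp.single_add_single_eq_single_add_single one_ne_zero one_ne_zero).1 h with
        ⟨h1, h2⟩ | ⟨-, h1, h2⟩ | ⟨h1, -, -⟩
      · exact ⟨h1, h2⟩
      · exact absurd (h1 ▸ he) he₀'
      · exact absurd h1 (by norm_num)
    rw [Finset.sum_eq_single_of_mem e₀ he₀, Finset.sum_eq_single_of_mem e₀' he₀'c, if_pos rfl]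
    · intro e' he' hne
      rw [if_neg]
      intro h; exact hne (key e₀ he₀ e' he' h).2
    · intro e he hne
      refine Finset.sum_eq_zero fun e' he' => ?_
      rw [if_neg]
      intro h; exact hne (key e he e' he' h).1

/-- Evaluation of an `S`-bilinear quadric. -/
theorem eval_bilinear (S : Finset (Fin 4 × Fin 4)) {f : R44}
    (hw : IsWeightedHomogeneous (wS S) f 1) (h2 : f.IsHomogeneous 2) (v : Fin 4 × Fin 4 → ℂ) :
    eval v f = ∑ e ∈ S, ∑ e' ∈ Sᶜ, coeff (single e 1 + single e' 1) f * (v e * v e') := by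
  conv_lhs => rw [bilinear_expand S hw h2]
  simp only [map_sum, map_mul, eval_C, eval_X]


/-! ### BP-2: the point family `pt σ zz` (rows `σ 0, σ 1` fixed to `(1,1,1,1)`, `(1,-1,1,1)`,
rows `σ 2, σ 3` free) -/

def sVec : Fin 4 → ℂ := ![1, -1, 1, 1]
def uVec : Fin 4 → ℂ := ![1, 0, -1, 0]

theorem sVec_ne_zero (c : Fin 4) : sVec c ≠ 0 := by
  fin_cases c <;> simp [sVec]

/-- the base point: row 0 = 𝟙, row 1 = sVec, rows 2, 3 = the free values `zz` -/
def base (zz : Fin 2 × Fin 4 → ℂ) : Fin 4 × Fin 4 → ℂ := fun e =>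
  if e.1 = 0 then 1 else if e.1 = 1 then sVec e.2 else if e.1 = 2 then zz (0, e.2) else zz (1, e.2)

/-- the point, with the fixed rows moved to `σ 0, σ 1` -/
def pt (σ : Equiv.Perm (Fin 4)) (zz : Fin 2 × Fin 4 → ℂ) : Fin 4 × Fin 4 → ℂ :=
  fun e => base zz (σ.symm e.1, e.2)

/-- which free row a cell is read from -/
def τ (σ : Equiv.Perm (Fin 4)) (e : Fin 4 × Fin 4) : Fin 2 × Fin 4 :=
  (if σ.symm e.1 = 2 then 0 else 1, e.2)

variable {i i' : Fin 4} {σ : Equiv.Perm (Fin 4)}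

theorem pt_row_fst (h0 : σ 0 = i) (zz : Fin 2 × Fin 4 → ℂ) (c : Fin 4) : pt σ zz (i, c) = 1 := by
  have : σ.symm i = 0 := by rw [← h0, Equiv.symm_apply_apply]
  simp [pt, base, this]

theorem pt_row_snd (h0 : σ 0 = i) (h1 : σ 1 = i') (zz : Fin 2 × Fin 4 → ℂ) (c : Fin 4) :
    pt σ zz (i', c) = sVec c := by
  have : σ.symm i' = 1 := by rw [← h1, Equiv.symm_apply_apply]
  simp [pt, base, this]

theorem pt_of_mem (h0 : σ 0 = i) (h1 : σ 1 = i') (zz zz' : Fin 2 × Fin 4 → ℂ) {e : Fin 4 × Fin 4}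
    (he : e ∈ twoRows i i') : pt σ zz e = pt σ zz' e := by
  simp only [twoRows, Finset.mem_filter, Finset.mem_univ, true_and] at he
  obtain ⟨r, c⟩ := e
  rcases he with rfl | rfl
  · rw [pt_row_fst h0, pt_row_fst h0]
  · rw [pt_row_snd h0 h1, pt_row_snd h0 h1]

theorem pt_ne_zero_of_mem (h0 : σ 0 = i) (h1 : σ 1 = i') (zz : Fin 2 × Fin 4 → ℂ)
    {e : Fin 4 × Fin 4} (he : e ∈ twoRows i i') : pt σ zz e ≠ 0 := by
  simp only [twoRows, Finset.mem_filter, Finset.mem_univ, true_and] at he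
  obtain ⟨r, c⟩ := e
  rcases he with rfl | rfl
  · rw [pt_row_fst h0]; exact one_ne_zero
  · rw [pt_row_snd h0 h1]; exact sVec_ne_zero c

theorem pt_of_not_mem (h0 : σ 0 = i) (h1 : σ 1 = i') (zz : Fin 2 × Fin 4 → ℂ) {e : Fin 4 × Fin 4}
    (he : e ∉ twoRows i i') : pt σ zz e = zz (τ σ e) := by
  simp only [twoRows, Finset.mem_filter, Finset.mem_univ, true_and, not_or] at he
  have hr0 : σ.symm e.1 ≠ 0 := fun h => he.1 (by rw [← h0, ← h, Equiv.apply_symm_apply])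
  have hr1 : σ.symm e.1 ≠ 1 := fun h => he.2 (by rw [← h1, ← h, Equiv.apply_symm_apply])
  have h23 : σ.symm e.1 = 2 ∨ σ.symm e.1 = 3 := by
    revert hr0 hr1; generalize σ.symm e.1 = r; revert r; decide
  rcases h23 with h | h
  · simp [pt, base, τ, h]
  · simp [pt, base, τ, h]

/-! ### BP-3: evaluation of a bilinear quadric along the family is linear in `zz` -/

theorem eval_pt_bilinear (h0 : σ 0 = i) (h1 : σ 1 = i') {f : R44}
    (hw : IsWeightedHomogeneous (wS (twoRows i i')) f 1) (h2 : f.IsHomogeneous 2)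
    (zz : Fin 2 × Fin 4 → ℂ) :
    eval (pt σ zz) f = ∑ e ∈ twoRows i i', ∑ e' ∈ (twoRows i i')ᶜ,
      coeff (single e 1 + single e' 1) f * pt σ 0 e * zz (τ σ e') := by
  rw [eval_bilinear _ hw h2]
  refine Finset.sum_congr rfl fun e he => Finset.sum_congr rfl fun e' he' => ?_
  rw [pt_of_mem h0 h1 zz 0 he, pt_of_not_mem h0 h1 zz (Finset.mem_compl.1 he'), mul_assoc]

theorem eval_pt_add (h0 : σ 0 = i) (h1 : σ 1 = i') {f : R44}
    (hw : IsWeightedHomogeneous (wS (twoRows i i')) f 1) (h2 : f.IsHomogeneous 2)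
    (zz zz' : Fin 2 × Fin 4 → ℂ) :
    eval (pt σ (zz + zz')) f = eval (pt σ zz) f + eval (pt σ zz') f := by
  simp only [eval_pt_bilinear h0 h1 hw h2, Pi.add_apply, mul_add, Finset.sum_add_distrib]

theorem eval_pt_smul (h0 : σ 0 = i) (h1 : σ 1 = i') {f : R44}
    (hw : IsWeightedHomogeneous (wS (twoRows i i')) f 1) (h2 : f.IsHomogeneous 2)
    (c : ℂ) (zz : Fin 2 × Fin 4 → ℂ) :
    eval (pt σ (c • zz)) f = c * eval (pt σ zz) f := by
  simp only [eval_pt_bilinear h0 h1 hw h2, Pi.smul_apply, smul_eq_mul, Finset.mul_sum]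
  refine Finset.sum_congr rfl fun e _ => Finset.sum_congr rfl fun e' _ => ?_
  ring

/-! ### BP-4: the permanent along the family and its translation invariance -/

/-- Row permutations fix the generic permanent. [folklore] -/
theorem rename_rowPerm_perPoly (π : Equiv.Perm (Fin 4)) :
    rename (fun v : Fin 4 × Fin 4 => (π v.1, v.2)) (perPoly (Fin 4) ℂ) = perPoly (Fin 4) ℂ := by
  have h1 : rename (fun v : Fin 4 × Fin 4 => (π v.1, v.2)) (perPoly (Fin 4) ℂ) =
      ((Matrix.mvPolynomialX (Fin 4) (Fin 4) ℂ).map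
        (rename (fun v : Fin 4 × Fin 4 => (π v.1, v.2)))).permanent := by
    simp only [perPoly, Matrix.permanent, map_sum, map_prod, Matrix.map_apply]
  have h2 : (Matrix.mvPolynomialX (Fin 4) (Fin 4) ℂ).map
      (rename (fun v : Fin 4 × Fin 4 => (π v.1, v.2))) =
      (Matrix.mvPolynomialX (Fin 4) (Fin 4) ℂ).submatrix π id := by
    ext i j; simp [Matrix.mvPolynomialX_apply, rename_X]
  rw [h1, h2, Matrix.permanent_permute_cols]; rfl

theorem eval_pt_perPoly (σ : Equiv.Perm (Fin 4)) (zz : Fin 2 × Fin 4 → ℂ) :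
    eval (pt σ zz) (perPoly (Fin 4) ℂ) = eval (base zz) (perPoly (Fin 4) ℂ) := by
  have : pt σ zz = base zz ∘ fun v : Fin 4 × Fin 4 => (σ.symm v.1, v.2) := rfl
  rw [this, ← eval_rename, rename_rowPerm_perPoly]

/-- the shift: free row `σ 2 ↦ 0`, free row `σ 3 ↦ uVec` -/
def zzStar : Fin 2 × Fin 4 → ℂ := fun tc => if tc.1 = 0 then 0 else uVec tc.2

theorem zzStar_ne_zero : zzStar ≠ 0 := by
  intro h
  have := congrFun h (1, 0)
  simp [zzStar, uVec] at this

/-- `per₄(y₀, z + z*) = per₄(y₀, z)`: `M(y₀) · uVec = 0`, `per₄(y, z) = z_rᵀ M(y) z_{r'}`. -/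
theorem eval_base_perPoly_shift (zz : Fin 2 × Fin 4 → ℂ) :
    eval (base (zz + zzStar)) (perPoly (Fin 4) ℂ) = eval (base zz) (perPoly (Fin 4) ℂ) := by
  rw [eval_perPoly, eval_perPoly, Matrix.permanent_fin_four_row, Matrix.permanent_fin_four_row]
  simp only [Matrix.of_apply, base, zzStar, sVec, uVec, Pi.add_apply]
  simp only [eq_self_iff_true,
    show ((1 : Fin 4) = 0) = False by decide, show ((2 : Fin 4) = 0) = False by decide,
    show ((3 : Fin 4) = 0) = False by decide,
    show ((2 : Fin 4) = 1) = False by decide, show ((3 : Fin 4) = 1) = False by decide,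
    show ((3 : Fin 4) = 2) = False by decide,
    show ((1 : Fin 2) = 0) = False by decide,
    if_true, if_false, Matrix.cons_val_zero, Matrix.cons_val_one, Matrix.head_cons,
    Matrix.cons_val_two, Matrix.cons_val_three, Matrix.tail_cons]
  ring

theorem eval_pt_perPoly_shift (σ : Equiv.Perm (Fin 4)) (zz : Fin 2 × Fin 4 → ℂ) :
    eval (pt σ (zz + zzStar)) (perPoly (Fin 4) ℂ) = eval (pt σ zz) (perPoly (Fin 4) ℂ) := by
  rw [eval_pt_perPoly, eval_pt_perPoly, eval_base_perPoly_shift]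


/-! ### BP-5: the linear map `zz ↦ (a_k(pt zz), b_k(pt zz))_k` and the dichotomy -/

theorem exists_perm_fin_four (r₁ r₂ : Fin 4) (h : r₁ ≠ r₂) :
    ∃ σ : Equiv.Perm (Fin 4), σ 0 = r₁ ∧ σ 1 = r₂ := by
  revert r₁ r₂
  decide

/-- the evaluation map of the eight bilinear quadrics along the family, a linear endomorphism of
`ℂ^{2 × 4}` -/
def Lam (σ : Equiv.Perm (Fin 4)) (h0 : σ 0 = i) (h1 : σ 1 = i') (a b : Fin 4 → R44)
    (hab : ∀ k, IsWeightedHomogeneous (wS (twoRows i i')) (a k) 1 ∧ (a k).IsHomogeneous 2 ∧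
      IsWeightedHomogeneous (wS (twoRows i i')) (b k) 1 ∧ (b k).IsHomogeneous 2) :
    (Fin 2 × Fin 4 → ℂ) →ₗ[ℂ] (Fin 2 × Fin 4 → ℂ) where
  toFun zz := fun tk => if tk.1 = 0 then eval (pt σ zz) (a tk.2) else eval (pt σ zz) (b tk.2)
  map_add' zz zz' := by
    funext tk
    simp only [Pi.add_apply]
    split_ifs
    · exact eval_pt_add h0 h1 (hab tk.2).1 (hab tk.2).2.1 zz zz'
    · exact eval_pt_add h0 h1 (hab tk.2).2.2.1 (hab tk.2).2.2.2 zz zz'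
  map_smul' c zz := by
    funext tk
    simp only [Pi.smul_apply, smul_eq_mul, RingHom.id_apply]
    split_ifs
    · exact eval_pt_smul h0 h1 (hab tk.2).1 (hab tk.2).2.1 c zz
    · exact eval_pt_smul h0 h1 (hab tk.2).2.2.1 (hab tk.2).2.2.2 c zz

theorem Lam_apply_zero (h0 : σ 0 = i) (h1 : σ 1 = i') (a b : Fin 4 → R44) (hab) (zz) (k : Fin 4) :
    Lam σ h0 h1 a b hab zz (0, k) = eval (pt σ zz) (a k) := by
  simp [Lam]

theorem Lam_apply_one (h0 : σ 0 = i) (h1 : σ 1 = i') (a b : Fin 4 → R44) (hab) (zz) (k : Fin 4) :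
    Lam σ h0 h1 a b hab zz (1, k) = eval (pt σ zz) (b k) := by
  simp [Lam]

/-- a split form `Σ_k w(0,k) w(1,k)` on `ℂ^{2×4}` has no nonzero translation-invariant direction -/
theorem splitForm_shift_eq_zero (w' : Fin 2 × Fin 4 → ℂ)
    (h : ∀ w : Fin 2 × Fin 4 → ℂ,
      ∑ k, (w + w') (0, k) * (w + w') (1, k) = ∑ k, w (0, k) * w (1, k)) : w' = 0 := by
  have hB0 : ∑ k, w' (0, k) * w' (1, k) = 0 := by simpa using h 0
  funext tk
  obtain ⟨t, k⟩ := tk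
  rw [Pi.zero_apply]
  fin_cases t
  · -- test against the indicator of `(1, k)`
    have h1 := h (fun tc => if tc = (1, k) then 1 else 0)
    simp only [Pi.add_apply, Prod.mk.injEq, show ((0 : Fin 2) = 1) = False by decide, false_and,
      if_false, zero_add, true_and, zero_mul, Finset.sum_const_zero, mul_add, mul_ite, mul_one,
      mul_zero, Finset.sum_add_distrib, Finset.sum_ite_eq', Finset.mem_univ, if_true, hB0,
      add_zero] at h1
    simpa using h1
  · have h1 := h (fun tc => if tc = (0, k) then 1 else 0)
    simp only [Pi.add_apply, Prod.mk.injEq, show ((1 : Fin 2) = 0) = False by decide, false_and,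
      if_false, zero_add, true_and, mul_zero, Finset.sum_const_zero, add_mul, ite_mul, one_mul,
      zero_mul, Finset.sum_add_distrib, Finset.sum_ite_eq', Finset.mem_univ, if_true, hB0,
      add_zero] at h1
    simpa using h1

/-- **The bad point — PROVED (v8).**  For two rows `i ≠ i'` and a width-4 decomposition
`per₄ = Σ a_k b_k` into `{i,i'}`-bilinear quadrics there is a common zero of the eight quadrics with
rows `i, i'` zero-free and some nonzero entry off rows `i, i'`.  Proof: along the family `pt σ zz`
(rows `i, i'` frozen to `(1,1,1,1), (1,-1,1,1)`, the other two rows `= zz`) the map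
`Λ : zz ↦ (a_k(pt zz), b_k(pt zz))_k` is a linear endomorphism of `ℂ^{2×4}` (`Lam`); a nonzero kernel
vector is the point; otherwise `Λ` is bijective (`LinearMap.injective_iff_surjective`) and
`per₄ ∘ pt = (split form) ∘ Λ` would inherit the translation invariance
`per₄(pt (zz + zz*)) = per₄(pt zz)` (`eval_pt_perPoly_shift`: `M(y₀)·(1,0,-1,0) = 0`), forcing
`Λ zz* = 0` (`splitForm_shift_eq_zero`), i.e. `zz* = 0` — but `zz* ≠ 0`. [original] -/
theorem twoRows_badPoint (hii' : i ≠ i') (a b : Fin 4 → R44)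
    (hab : ∀ k, IsWeightedHomogeneous (wS (twoRows i i')) (a k) 1 ∧ (a k).IsHomogeneous 2 ∧
      IsWeightedHomogeneous (wS (twoRows i i')) (b k) 1 ∧ (b k).IsHomogeneous 2)
    (hper : perPoly (Fin 4) ℂ = ∑ k, a k * b k) :
    ∃ p : Fin 4 × Fin 4 → ℂ, (∀ k, eval p (a k) = 0 ∧ eval p (b k) = 0) ∧
      (∀ c, p (i, c) ≠ 0) ∧ (∀ c, p (i', c) ≠ 0) ∧ ∃ e, e.1 ≠ i ∧ e.1 ≠ i' ∧ p e ≠ 0 := by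
  classical
  obtain ⟨σ, h0, h1⟩ := exists_perm_fin_four i i' hii'
  set Λ := Lam σ h0 h1 a b hab with hΛ
  -- `per₄` along the family is the split form of `Λ`
  have hQ : ∀ zz, eval (pt σ zz) (perPoly (Fin 4) ℂ) = ∑ k, Λ zz (0, k) * Λ zz (1, k) := by
    intro zz
    rw [hper, map_sum]
    simp only [map_mul, hΛ, Lam_apply_zero, Lam_apply_one]
  by_cases hinj : Function.Injective Λ
  · exfalso
    have hsurj : Function.Surjective Λ := LinearMap.injective_iff_surjective.1 hinj
    have hshift : ∀ w : Fin 2 × Fin 4 → ℂ,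
        ∑ k, (w + Λ zzStar) (0, k) * (w + Λ zzStar) (1, k) = ∑ k, w (0, k) * w (1, k) := by
      intro w
      obtain ⟨zz, rfl⟩ := hsurj w
      rw [← map_add, ← hQ, ← hQ, eval_pt_perPoly_shift]
    have hzero : Λ zzStar = 0 := splitForm_shift_eq_zero _ hshift
    exact zzStar_ne_zero (hinj (by rw [hzero, map_zero]))
  · obtain ⟨zz₁, zz₂, heq, hne⟩ : ∃ zz₁ zz₂, Λ zz₁ = Λ zz₂ ∧ zz₁ ≠ zz₂ := by
      simpa [Function.Injective] using hinj
    set zz := zz₁ - zz₂ with hzzdef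
    have hzz : zz ≠ 0 := sub_ne_zero.2 hne
    have hΛzz : Λ zz = 0 := by rw [hzzdef, map_sub, heq, sub_self]
    refine ⟨pt σ zz, fun k => ⟨?_, ?_⟩, fun c => ?_, fun c => ?_, ?_⟩
    · rw [← Lam_apply_zero h0 h1 a b hab zz k, ← hΛ, hΛzz, Pi.zero_apply]
    · rw [← Lam_apply_one h0 h1 a b hab zz k, ← hΛ, hΛzz, Pi.zero_apply]
    · rw [pt_row_fst h0]; exact one_ne_zero
    · rw [pt_row_snd h0 h1]; exact sVec_ne_zero c
    · obtain ⟨⟨t, c⟩, htc⟩ : ∃ tc, zz tc ≠ 0 := by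
        by_contra h
        push Not at h
        exact hzz (funext h)
      refine ⟨(σ (if t = 0 then 2 else 3), c), ?_, ?_, ?_⟩
      · rw [← h0]
        intro h
        have := σ.injective h
        revert this
        split_ifs <;> decide
      · rw [← h1]
        intro h
        have := σ.injective h
        revert this
        split_ifs <;> decide
      · show base zz (σ.symm (σ _), c) ≠ 0
        rw [Equiv.symm_apply_apply]
        fin_cases t <;> simpa +decide [base] using htc

end BadPoint

/-- (v7's registered stub `stub_twoRows_badPoint`, now a theorem.) -/
theorem stub_twoRows_badPoint {i i' : Fin 4} (hii' : i ≠ i') (a b : Fin 4 → R44)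
    (hab : ∀ k, IsWeightedHomogeneous (wS (twoRows i i')) (a k) 1 ∧ (a k).IsHomogeneous 2 ∧
      IsWeightedHomogeneous (wS (twoRows i i')) (b k) 1 ∧ (b k).IsHomogeneous 2)
    (hper : perPoly (Fin 4) ℂ = ∑ k, a k * b k) :
    ∃ pt : Fin 4 × Fin 4 → ℂ, (∀ k, eval pt (a k) = 0 ∧ eval pt (b k) = 0) ∧
      (∀ c, pt (i, c) ≠ 0) ∧ (∀ c, pt (i', c) ≠ 0) ∧ ∃ e, e.1 ≠ i ∧ e.1 ≠ i' ∧ pt e ≠ 0 :=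
  twoRows_badPoint hii' a b hab hper

/-! ### Assembly of C from C-i, C-ii/C-iii-a and the bad point -/

/-- the two-ROWS case, from B and the bad-point stub -/
theorem twoRowsCase_of_topPrimeRigidity (hB : TopPrimeRigidity) {i i' : Fin 4} (hii' : i ≠ i')
    (p q : Fin 4 → R44) (hp : ∀ k, p k ∈ cellIdeal (twoRows i i'))
    (hq : ∀ k, q k ∈ cellIdeal (twoRows i i')) (hp2 : ∀ k, (p k).IsHomogeneous 2)
    (hq2 : ∀ k, (q k).IsHomogeneous 2) (hper : perPoly (Fin 4) ℂ = ∑ k, p k * q k) : False := by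
  obtain ⟨a, b, hab, hper'⟩ :=
    twoLine_bilinear_reduction hii' (twoRows i i') (Or.inl rfl) p q hp hq hp2 hq2 hper
  obtain ⟨pt, hpt, hi, hi', e, hei, hei', hpe⟩ := stub_twoRows_badPoint hii' a b hab hper'
  obtain ⟨r, r', hrr', hrows | hcols⟩ := commonZero_twoLine hB a b (fun k => (hab k).2.1)
    (fun k => (hab k).2.2.2) hper' pt hpt
  · have hri : r ≠ i := fun h => hi 0 (h ▸ (hrows 0).1)
    have hri' : r ≠ i' := fun h => hi' 0 (h ▸ (hrows 0).1)
    have hr'i : r' ≠ i := fun h => hi 0 (h ▸ (hrows 0).2)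
    have hr'i' : r' ≠ i' := fun h => hi' 0 (h ▸ (hrows 0).2)
    have he : e.1 = r ∨ e.1 = r' := by
      have h1 := Fin.val_injective.ne hii'
      have h2 := Fin.val_injective.ne hrr'
      have h3 := Fin.val_injective.ne hri
      have h4 := Fin.val_injective.ne hri'
      have h5 := Fin.val_injective.ne hr'i
      have h6 := Fin.val_injective.ne hr'i'
      have h7 := Fin.val_injective.ne hei
      have h8 := Fin.val_injective.ne hei'
      rw [Fin.ext_iff, Fin.ext_iff]
      have := i.isLt; have := i'.isLt; have := r.isLt; have := r'.isLt; have := e.1.isLt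
      omega
    rcases he with he | he
    · exact hpe (by rw [show e = (r, e.2) from Prod.ext he rfl]; exact (hrows e.2).1)
    · exact hpe (by rw [show e = (r', e.2) from Prod.ext he rfl]; exact (hrows e.2).2)
  · exact hi r (hcols i).1

theorem image_swap_twoCols (j j' : Fin 4) : (twoCols j j').image Prod.swap = twoRows j j' := by
  ext e
  simp only [twoRows, twoCols, Finset.mem_image, Finset.mem_filter, Finset.mem_univ, true_and]
  constructor
  · rintro ⟨e', h, rfl⟩; simpa using h
  · intro h; exact ⟨e.swap, by simpa using h, Prod.swap_swap e⟩

/-- **C GIVEN B**, now a THEOREM of C-i + C-ii + C-iii-a (proved) and the bad-point stub; the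
two-columns case is transported to two rows by `tr`. -/
theorem twoLineCase_of_topPrimeRigidity (hB : TopPrimeRigidity) : TwoLineCase := by
  intro i i' hii' S hS p q hp hq ⟨hp2, hq2, hper⟩
  rcases hS with rfl | rfl
  · exact twoRowsCase_of_topPrimeRigidity hB hii' p q hp hq hp2 hq2 hper
  · -- transpose
    have hmem : ∀ f : R44, f ∈ cellIdeal (twoCols i i') → tr f ∈ cellIdeal (twoRows i i') := by
      intro f hf
      have := Ideal.mem_map_of_mem tr hf
      rwa [map_tr_cellIdeal, image_swap_twoCols] at this
    refine twoRowsCase_of_topPrimeRigidity hB hii' (fun k => tr (p k)) (fun k => tr (q k))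
      (fun k => hmem _ (hp k)) (fun k => hmem _ (hq k))
      (fun k => by rw [tr_apply]; exact (hp2 k).rename_isHomogeneous)
      (fun k => by rw [tr_apply]; exact (hq2 k).rename_isHomogeneous) ?_
    have := congrArg tr hper
    rw [tr_perPoly, map_sum] at this
    simpa only [map_mul] using this


/-- Stub C GIVEN B of v4–v6 (`TopPrimeRigidity → TwoLineCase`) is a THEOREM: v7 modulo the bad point,
v8 sorry-free end to end. -/
theorem stub_twoLineCase_of_topPrimeRigidity : TopPrimeRigidity → TwoLineCase :=
  twoLineCase_of_topPrimeRigidity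

/-- Stub C of v1–v3 is B + the conditional theorem. -/
theorem stub_twoLineCase : TwoLineCase :=
  stub_twoLineCase_of_topPrimeRigidity stub_topPrimeRigidity

/-- **BY-NAME ANCHOR (v8.2, record only — director-valiant R228 (a)).**  Stub C GIVEN B is ALSO the tree
theorem `TwoLine.twoLineCase_of_topPrimeRigidity` of port-2 g1 (p628909 `…TwoLineCase.lean`, over p627728
`…TwoLineBilinear` / p628193 `…TwoLineForms`): its unfolded hypothesis and conclusion ARE `TopPrimeRigidity` and
`TwoLineCase`, definitionally (this `theorem` elaborating is the δ-check). -/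
theorem stub_twoLineCase_of_topPrimeRigidity_byName : TopPrimeRigidity → TwoLineCase :=
  Theorems.PolyaContinuedLaplaceRigidity.TwoLine.twoLineCase_of_topPrimeRigidity

end StubC

/-! ## Glue, part 2 — the kernel-checked composition -/

/-- **The line's composition**: top-prime rigidity of `Sing(per₄)` and the two-line case imply the rung
`str₂(per₄) ≥ 5`.  Kumar's ideal `J = (p_k, q_k)` is proper with `≤ 8` generators and contains
`singIdeal per₄ = singPermIdeal ℂ 4`; a minimal prime `Q ⊇ J` has height `≤ 8` (Krull,
`Ideal.height_le_card_of_mem_minimalPrimes_span_finset`); apply `TopPrimeRigidity` to `Q`: type (X)/(K)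
puts every `p_k, q_k` (homogeneous quadrics of `Q`) in `(x_{row i ∪ col c})`, so `per₄ ∈ (x_S)²`,
contradicting `perPoly_not_mem_sdegIdeal_rowCol`; type (L) is `TwoLineCase` verbatim.
[cite: GesmundoGhosalIkenmeyerLysikov2022, Prop. 6] -/
theorem strengthTwoPerFourGeFive_of :
    TopPrimeRigidity → TwoLineCase → StrengthTwoPerFourGeFive := by
  intro hB hC p q hpq
  obtain ⟨hp, hq, hf⟩ := hpq
  classical
  set S : Finset (MvPolynomial (Fin 4 × Fin 4) ℂ) := Finset.univ.image p ∪ Finset.univ.image q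
    with hS
  set I : Ideal (MvPolynomial (Fin 4 × Fin 4) ℂ) := Ideal.span (S : Set _) with hI
  have hpI : ∀ k, p k ∈ I := fun k => Ideal.subset_span (Finset.mem_coe.2
    (Finset.mem_union_left _ (Finset.mem_image_of_mem p (Finset.mem_univ k))))
  have hqI : ∀ k, q k ∈ I := fun k => Ideal.subset_span (Finset.mem_coe.2
    (Finset.mem_union_right _ (Finset.mem_image_of_mem q (Finset.mem_univ k))))
  have hScard : S.card ≤ 8 :=
    calc S.card ≤ (Finset.univ.image p).card + (Finset.univ.image q).card :=
          Finset.card_union_le _ _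
      _ ≤ (Finset.univ : Finset (Fin 4)).card + (Finset.univ : Finset (Fin 4)).card :=
          add_le_add Finset.card_image_le Finset.card_image_le
      _ = 8 := by simp
  have hsing : singIdeal (perPoly (Fin 4) ℂ) ≤ I :=
    Theorems.PolyaContinuedLaplaceRigidity.Strength.singIdeal_le_of_eq_sum_mul p q hf I hpI hqI
  -- `I` is proper: all generators are homogeneous quadrics, hence constant-free
  have hIker : I ≤ RingHom.ker (constantCoeff : MvPolynomial (Fin 4 × Fin 4) ℂ →+* ℂ) := by
    rw [hI, Ideal.span_le]
    intro g hg
    rw [SetLike.mem_coe, RingHom.mem_ker]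
    rw [Finset.mem_coe, hS, Finset.mem_union, Finset.mem_image, Finset.mem_image] at hg
    rcases hg with ⟨k, -, rfl⟩ | ⟨k, -, rfl⟩
    · exact AlperBogartVelasco.constantCoeff_eq_zero_of_isHomogeneous (hp k) two_ne_zero
    · exact AlperBogartVelasco.constantCoeff_eq_zero_of_isHomogeneous (hq k) two_ne_zero
  have hItop : I ≠ ⊤ := fun htop => RingHom.ker_ne_top _ (top_le_iff.1 (htop ▸ hIker))
  obtain ⟨Q, hQ⟩ := Ideal.nonempty_minimalPrimes hItop
  have hQprime : Q.IsPrime := hQ.1.1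
  have hIQ : I ≤ Q := hQ.1.2
  have hQ8 : Q.height ≤ 8 :=
    (Ideal.height_le_card_of_mem_minimalPrimes_span_finset hQ).trans (by exact_mod_cast hScard)
  have hsingQ : VonZurGathen.singPermIdeal ℂ 4 ≤ Q := by
    rw [← singIdeal_perPoly]
    exact hsing.trans hIQ
  rcases hB Q hQprime hsingQ hQ8 with ⟨i, c, h1⟩ | ⟨i, i', hii', hP⟩
  · -- types (X) / (K): all quadrics of `Q` lie in `(x_{row i ∪ col c})`
    have hp' : ∀ k, p k ∈ sdegIdeal (rowCol i c) 1 := fun k =>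
      cellIdeal_le_sdegIdeal _ (h1 _ (hIQ (hpI k)) (hp k))
    have hq' : ∀ k, q k ∈ sdegIdeal (rowCol i c) 1 := fun k =>
      cellIdeal_le_sdegIdeal _ (h1 _ (hIQ (hqI k)) (hq k))
    refine perPoly_not_mem_sdegIdeal_rowCol i c ?_
    rw [hf]
    exact Ideal.sum_mem _ fun k _ => sdegIdeal_mul_le _ 1 1 (Ideal.mul_mem_mul (hp' k) (hq' k))
  · -- type (L): `Q` is the ideal of two parallel lines
    rcases hP with hP | hP
    · exact hC i i' hii' _ (Or.inl rfl) p q (fun k => hP ▸ hIQ (hpI k))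
        (fun k => hP ▸ hIQ (hqI k)) ⟨hp, hq, hf⟩
    · exact hC i i' hii' _ (Or.inr rfl) p q (fun k => hP ▸ hIQ (hpI k))
        (fun k => hP ▸ hIQ (hqI k)) ⟨hp, hq, hf⟩

/-- **The rung, end to end — SORRY-FREE (v8.1):** `str₂(per₄) ≥ 5`. -/
theorem strengthTwoPerFourGeFive_holds : StrengthTwoPerFourGeFive :=
  strengthTwoPerFourGeFive_of stub_topPrimeRigidity stub_twoLineCase

/-! ## By-name anchors to the Theorems-side port (v8.3, record only — director-valiant R231 (d))

The rung is ALSO a tree theorem and the ledger item is CLOSED: stmt-ValiantsHypothesis-27571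
`Theses.PolyaContinued.StrengthTwoPerFourGeFive` · support r9 · **CLOSED · proved 2026-08-28T11:36:03Z** by
`Theorems.PolyaContinuedLaplaceRigidity.StrengthFive.strengthTwoPerFourGeFive` (✓ p629836
`Theorems/PolyaContinuedStrengthTwoPerFourGeFive.lean`, val-port-2 g1) over stub B = `TopPrime.topPrimeRigidity`
(✓ p629522 `Theorems/PolyaContinuedLaplaceRigidityTopPrimeRigidity.lean`, val-port-2 g1: this file's `kcore_grading` /
B-row / transpose / B-col / top split, def-free) and stub C = `TwoLine.twoLineCase_of_topPrimeRigidity` (✓ p628909).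
The three declarations below elaborating are the δ-checks that the tree statements ARE this line's. -/

/-- stub B by name (✓ p629522). -/
theorem stub_topPrimeRigidity_byName : TopPrimeRigidity :=
  Theorems.PolyaContinuedLaplaceRigidity.TopPrime.topPrimeRigidity

/-- the rung by name (✓ p629836; = the closer of stmt-27571). -/
theorem strengthTwoPerFourGeFive_byName : StrengthTwoPerFourGeFive :=
  Theorems.PolyaContinuedLaplaceRigidity.StrengthFive.strengthTwoPerFourGeFive

/-- conversely, this file's in-house witness closes the LEDGER decl (token-identical statements). -/
example : Summit.ValiantsHypothesis.ValiantsHypothesis.Theses.PolyaContinued.StrengthTwoPerFourGeFive :=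
  strengthTwoPerFourGeFive_holds

/-! ## Consistency anchors (sorry-free): the rung below and the item above, by name -/

/-- The rung below (`str₂(per₄) ≥ 4`, PROVED in the tree) in this file's shape, for the record. -/
theorem strengthTwoPerFourGeFour_anchor :
    ∀ p q : Fin 3 → MvPolynomial (Fin 4 × Fin 4) ℂ,
      ¬ ((∀ i, (p i).IsHomogeneous 2) ∧ (∀ i, (q i).IsHomogeneous 2) ∧
        perPoly (Fin 4) ℂ = ∑ i, p i * q i) :=
  Theorems.PolyaContinuedLaplaceRigidity.Strength.strengthTwoPerFourGeFour_of_seven_le_height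
    (by rw [Theorems.PolyaContinuedLaplaceRigidity.SingCodim.height_singIdeal_perPoly_four ℂ
          (by norm_num) (by norm_num)]; norm_num)

/-- The item above: the route's support item `StrengthTwoPerFour` (stmt-25160, width 5) implies this
rung (padding a width-4 decomposition with `p₄ = q₄ = 0`) — so the rung is strictly between the closed
`≥ 4` and the gated `= 6`. -/
theorem strengthTwoPerFourGeFive_of_strengthTwoPerFour
    (h : Theses.PolyaContinued.StrengthTwoPerFour) : StrengthTwoPerFourGeFive := by
  intro p q ⟨hp, hq, hf⟩
  refine h (Fin.snoc p 0) (Fin.snoc q 0) ⟨?_, ?_, ?_⟩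
  · intro i
    refine Fin.lastCases ?_ (fun j => ?_) i
    · rw [Fin.snoc_last]
      exact isHomogeneous_zero _ _ _
    · simpa using hp j
  · intro i
    refine Fin.lastCases ?_ (fun j => ?_) i
    · rw [Fin.snoc_last]
      exact isHomogeneous_zero _ _ _
    · simpa using hq j
  · rw [Fin.sum_univ_castSucc]
    simp only [Fin.snoc_castSucc, Fin.snoc_last, mul_zero, add_zero]
    exact hf



/-! ## Certified identities behind the card (sorry-free; `R` any commutative ring)

The closed form of `det M(u,v)` (symmetric zero-diagonal determinant = matching form
`A² + B² + C² − 2(AB + BC + CA)`, torus slice `(∏u)²(16e₄ − 4e₁e₃)`), the discriminant factorisation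
used for the irreducibility of the octic, the `t₁`-expansion of `F` on the hyperplanes `t₂ = γt₁`
(S2's witness `b ∤ det M`), the 4-cycle rank condition (S1), and the cofactor factorisations with the
two evaluation witnesses (S3's «no common factor»).  All by `ring` / `Matrix.det_fin_three`. -/
namespace Cert

variable {R : Type*} [CommRing R]



/-- Determinant of a symmetric zero-diagonal `4 × 4` matrix in terms of the three perfect-matching
products `A = m₁₂m₃₄`, `B = m₁₃m₂₄`, `C = m₁₄m₂₃`. -/
theorem det_symm_zeroDiag_four (a b c d e f : R) :
    (!![(0 : R), a, b, c; a, 0, d, e; b, d, 0, f; c, e, f, 0]).det =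
      (a * f) ^ 2 + (b * e) ^ 2 + (c * d) ^ 2
        - 2 * ((a * f) * (b * e) + (a * f) * (c * d) + (b * e) * (c * d)) := by
  rw [Matrix.det_succ_row_zero]
  simp [Fin.sum_univ_succ, Matrix.det_fin_three, Matrix.submatrix_apply, Fin.succAbove]
  ring

/-- The torus slice: with `p_{ab} = u_a u_b (t_a + t_b)` the matching form
`A² + B² + C² − 2(AB + BC + CA)` equals `(∏ u)² · (16 e₄(t) − 4 e₁(t) e₃(t))`. -/
theorem matchingForm_torus (u₁ u₂ u₃ u₄ t₁ t₂ t₃ t₄ : R) :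
    let A := (u₁ * u₂ * (t₁ + t₂)) * (u₃ * u₄ * (t₃ + t₄))
    let B := (u₁ * u₃ * (t₁ + t₃)) * (u₂ * u₄ * (t₂ + t₄))
    let C := (u₁ * u₄ * (t₁ + t₄)) * (u₂ * u₃ * (t₂ + t₃))
    A ^ 2 + B ^ 2 + C ^ 2 - 2 * (A * B + B * C + C * A) =
      (u₁ * u₂ * u₃ * u₄) ^ 2 *
        (16 * (t₁ * t₂ * t₃ * t₄)
          - 4 * (t₁ + t₂ + t₃ + t₄) * (t₁ * t₂ * t₃ + t₁ * t₂ * t₄ + t₁ * t₃ * t₄ + t₂ * t₃ * t₄)) := by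
  intro A B C
  ring

/-- `G = 4e₄ − e₁e₃` as a quadratic in `t₁` over `ℤ[t₂,t₃,t₄]` (`sᵢ` the elementary symmetric
polynomials of `t₂,t₃,t₄`). -/
theorem G_quadratic_in_t1 (t₁ t₂ t₃ t₄ : R) :
    let s₁ := t₂ + t₃ + t₄
    let s₂ := t₂ * t₃ + t₂ * t₄ + t₃ * t₄
    let s₃ := t₂ * t₃ * t₄
    4 * (t₁ * t₂ * t₃ * t₄)
        - (t₁ + t₂ + t₃ + t₄) * (t₁ * t₂ * t₃ + t₁ * t₂ * t₄ + t₁ * t₃ * t₄ + t₂ * t₃ * t₄) =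
      -s₂ * t₁ ^ 2 + (3 * s₃ - s₁ * s₂) * t₁ - s₁ * s₃ := by
  intro s₁ s₂ s₃
  ring

/-- Its discriminant factors as `(s₁s₂ − s₃)(s₁s₂ − 9s₃)` … -/
theorem discr_factor (s₁ s₂ s₃ : R) :
    (3 * s₃ - s₁ * s₂) ^ 2 - 4 * (-s₂) * (-(s₁ * s₃)) = (s₁ * s₂ - s₃) * (s₁ * s₂ - 9 * s₃) := by
  ring

/-- … with `s₁s₂ − s₃ = (t₂+t₃)(t₂+t₄)(t₃+t₄)` … -/
theorem s1s2_sub_s3 (t₂ t₃ t₄ : R) :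
    (t₂ + t₃ + t₄) * (t₂ * t₃ + t₂ * t₄ + t₃ * t₄) - t₂ * t₃ * t₄ = (t₂ + t₃) * (t₂ + t₄) * (t₃ + t₄) := by
  ring

/-- … and `(s₁s₂ − 9s₃)` does not vanish on `t₃ = −t₂`: it restricts to `8 t₂² t₄`. -/
theorem s1s2_sub_9s3_at (t₂ t₄ : R) :
    (t₂ + -t₂ + t₄) * (t₂ * -t₂ + t₂ * t₄ + -t₂ * t₄) - 9 * (t₂ * -t₂ * t₄) = 8 * t₂ ^ 2 * t₄ := by
  ring

/-- `F = 16e₄ − 4e₁e₃` on the hyperplane `t₂ = γ t₁`, as a polynomial in `t₁`: the `t₁³`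
coefficient is `−4γ(1+γ)(t₃+t₄)`. -/
theorem F_on_hyperplane (γ t₁ t₃ t₄ : R) :
    16 * (t₁ * (γ * t₁) * t₃ * t₄)
        - 4 * (t₁ + γ * t₁ + t₃ + t₄)
            * (t₁ * (γ * t₁) * t₃ + t₁ * (γ * t₁) * t₄ + t₁ * t₃ * t₄ + γ * t₁ * t₃ * t₄) =
      -4 * γ * (1 + γ) * (t₃ + t₄) * t₁ ^ 3
        + ((16 * γ - 4 * (1 + γ) ^ 2) * t₃ * t₄ - 4 * γ * (t₃ + t₄) ^ 2) * t₁ ^ 2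
        - 4 * (1 + γ) * t₃ * t₄ * (t₃ + t₄) * t₁ := by
  ring

/-- … and at `γ = −1` it is `4 t₁² (t₃ − t₄)²`. -/
theorem F_on_hyperplane_neg_one (t₁ t₃ t₄ : R) :
    16 * (t₁ * (-t₁) * t₃ * t₄)
        - 4 * (t₁ + -t₁ + t₃ + t₄)
            * (t₁ * (-t₁) * t₃ + t₁ * (-t₁) * t₄ + t₁ * t₃ * t₄ + (-t₁) * t₃ * t₄) =
      4 * t₁ ^ 2 * (t₃ - t₄) ^ 2 := by
  ring

/-- 4-cycle stratum: with `t₂ = −t₁`, `t₄ = −t₃` the rank condition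
`(t₁+t₃)(t₂+t₄) = (t₁+t₄)(t₂+t₃)` reads `t₁ t₃ = 0`. -/
theorem fourCycle_rank_condition (t₁ t₃ : R) :
    (t₁ + t₃) * (-t₁ + -t₃) - (t₁ + -t₃) * (-t₁ + t₃) = -(4 * (t₁ * t₃)) := by
  ring

/-- Cofactors of the zero-diagonal symmetric matrix with `m_{ab} = p_{{a,b}ᶜ}`: the principal one
`C₄₄ = 2 p₁₄ p₂₄ p₃₄` … -/
theorem cofactor_44 (p14 p24 p34 : R) :
    (!![(0 : R), p34, p24; p34, 0, p14; p24, p14, 0]).det = 2 * p14 * p24 * p34 := by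
  simp [Matrix.det_fin_three]; ring

/-- … `C₃₄ = −p₃₄ (−A + B + C)` (rows 1,2,4 × columns 1,2,3; `A = p₁₂p₃₄`, `B = p₁₃p₂₄`,
`C = p₁₄p₂₃`) … -/
theorem minor_34 (p12 p13 p14 p23 p24 p34 : R) :
    (!![(0 : R), p34, p24; p34, 0, p14; p23, p13, p12]).det =
      p34 * (-(p12 * p34) + p13 * p24 + p14 * p23) := by
  simp [Matrix.det_fin_three]; ring

/-- … `C₂₄ ∝ p₂₄ (−A + B − C)` (rows 1,3,4 × columns 1,2,3) … -/
theorem minor_24 (p12 p13 p14 p23 p24 p34 : R) :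
    (!![(0 : R), p34, p24; p24, p14, 0; p23, p13, p12]).det =
      p24 * (-(p12 * p34) + p13 * p24 - p14 * p23) := by
  simp [Matrix.det_fin_three]; ring

/-- … `C₁₄ ∝ p₁₄ (A + B − C)` (rows 2,3,4 × columns 1,2,3). -/
theorem minor_14 (p12 p13 p14 p23 p24 p34 : R) :
    (!![p34, (0 : R), p14; p24, p14, 0; p23, p13, p12]).det =
      p14 * (p12 * p34 + p13 * p24 - p14 * p23) := by
  simp [Matrix.det_fin_three]; ring

/-- No common factor: on `{p₁₄ = 0}` (`u = 𝟙`, `v₄ = −v₁`) the quartic `B − A` is `2v₁(v₂ − v₃)`;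
on `V(p₁₂, p₃₄)` (`u = 𝟙`, `v₂ = −v₁`, `v₄ = −v₃`) the quartic `B − C` is `−4 v₁ v₃`. -/
theorem witness_B_sub_A (v₁ v₂ v₃ : R) :
    (v₁ + v₃) * (v₂ + -v₁) - (v₁ + v₂) * (v₃ + -v₁) = 2 * v₁ * (v₂ - v₃) := by
  ring

theorem witness_B_sub_C (v₁ v₃ : R) :
    (v₁ + v₃) * (-v₁ + -v₃) - (v₁ + -v₃) * (-v₁ + v₃) = -(4 * (v₁ * v₃)) := by
  ring


/-! ### LEMMA B witnesses and the stub-C point (card v4) — `M(u,v)` at `u = 𝟙` has entries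
`M_{cd} = v_a + v_b` (`{a,b} = [4] ∖ {c,d}`). -/

/-- LEMMA B witness, `γ ≠ 1`: at `u = 𝟙`, `v = (1, γ, 1, −1)` (so `b = u₁v₂ − γu₂v₁ = 0`) the octic is
`h = det M = 4(1 − γ)²`.  Entries: `M₁₂ = v₃+v₄ = 0`, `M₁₃ = v₂+v₄ = γ−1`, `M₁₄ = v₂+v₃ = γ+1`,
`M₂₃ = v₁+v₄ = 0`, `M₂₄ = v₁+v₃ = 2`, `M₃₄ = v₁+v₂ = 1+γ`. -/
theorem lemmaB_witness (γ : R) :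
    (!![(0 : R), 0, γ - 1, γ + 1; 0, 0, 0, 2; γ - 1, 0, 0, 1 + γ; γ + 1, 2, 1 + γ, 0]).det =
      4 * (1 - γ) ^ 2 := by
  rw [det_symm_zeroDiag_four]; ring

/-- LEMMA B witness for `γ = 1`: at `u = 𝟙`, `v = (1, 1, 1, 0)` (again `b = u₁v₂ − u₂v₁ = 0`) the octic is
`h = det M = −12 ≠ 0`.  Entries: `M₁₂ = 1`, `M₁₃ = 1`, `M₁₄ = 2`, `M₂₃ = 1`, `M₂₄ = 2`, `M₃₄ = 2`. -/
theorem lemmaB_witness_one :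
    (!![(0 : R), 1, 1, 2; 1, 0, 1, 2; 1, 1, 0, 2; 2, 2, 2, 0]).det = -12 := by
  rw [det_symm_zeroDiag_four]; ring

/-- 17819-w1 g2's stub-C point: at `y₀ = ((1,1,1,1),(1,−1,1,1))`, `M(y₀) = [[0,2,0,0],[2,0,2,2],[0,2,0,0],
[0,2,0,0]]` and `M(y₀)·(1,0,−1,0) = 0` (so all 3×3 sub-permanents of `(y₀; 0; (1,0,−1,0))` vanish). -/
theorem stubC_point_kernel :
    (!![(0 : ℤ), 2, 0, 0; 2, 0, 2, 2; 0, 2, 0, 0; 0, 2, 0, 0]).mulVec ![1, 0, -1, 0] = 0 := by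
  decide

end Cert

end Summit.ValiantsHypothesis.ValiantsHypothesis.Cruxes.CoverDecancellation.ComponentRigidity

end
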